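/-
Copyright: statement-level skeleton of a published paper (lit-balaban cell, Phase-2 proof seat p26 gen 46). No claims beyond
what the kernel checks below.
-/
import Mathlib
import Literature.MathematicalPhysics.QuantumFieldTheory.Balaban1983to89.B3GraphAmplitudeSignedPositionForm
import Literature.MathematicalPhysics.QuantumFieldTheory.Balaban1983to89.B3Ineq213TorusBlocks
import Literature.MathematicalPhysics.QuantumFieldTheory.Balaban1983to89.B3Ineq210ZeroHiggsTorus

/-!
# B3 — T. Bałaban, *(Higgs)₂,₃ quantum fields in a finite volume. III. Renormalization*, CMP **88** (1983) 411–445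
[Balaban1983Higgs3] — p. 426 [PDF 16] (2.13) with (2.10) ∕ (2.11), p. 420 [PDF 10] (the localizations `{□(v)}`), and the torus
distance (1.3) p. 604 of part I [Balaban1982Higgs1]: **(2.13) FOR A BLOCK-LOCALIZED GRAPH ANYWHERE ON `T_η` IN THE SIGNED ((2.11))
CURRENCY, AND THE SCALAR-LINE HYPOTHESES DISCHARGED PER DIFFERENTIATION PATTERN** (FILE 19 of the Feynman-rule evaluator lineage;
companion of FILE 18 `B3Ineq213TorusBlocks`; item 5 ∕ § g45 PLUG-IN RECIPE of `HOME/lit-balaban-p26/DESIGN-B3-evaluator.md`).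

statement-level skeleton of published theorems with citation tags; proofs where landed; nothing here is a claim about
the Yang–Mills mass gap

PDF held: `paper:balaban1983-higgs-2-3-quantum-fields-finite-volume` (journal page = PDF page + 410); p. 420 [PDF 10] and
p. 426 [PDF 16] read by this seat on the text layer `~/.lit/texts/paper-balaban1983-higgs-2-3-quantum-fields-finite-volume/p0010.txt`,
`p0016.txt` (2026-08-25).

CITATION HEADER (lean-in-tree rule).  lit-balaban TYPED SKELETON (HOME `run/shared/lean/pub/lit-balaban/`), PHASE 2, seat p26 gen 46
(unit `lit-balaban-p26`; free-target protocol G.5-34(d), own lane, TAKING announced HOME/STATUS.md 2026-08-25T04:23Z).  ROWS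
**B3.Eq2.13-2.14** ((2.13) p. 426; head `proved` by p19's `B3Ineq213Proof`), **B3.Prop1** (p. 420), **B3.Def@420**, and for §5
**B3.Eq2.10** (head `proved`) of `HOME/lit-balaban-r15/ROWS-B3.md` (fold owner r15; this file is an OPTIONAL located member, cells only,
zero head weight).  CONSUMES BY NAME, nothing re-declared: FILE 14 `B3GraphAmplitudeSignedPositionForm` (p383823): `sigS`, `sigD`, `Lab`,
`Lab.pos`, `sigSK`, `sigVK`, `sigOK`, `sigB`, `sigO`, `UOf`, `UOf_nonneg`, `UOf_le_uOfKind`, `sum2_sigS_sigS`, `sum2_sigD_sigS`,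
`sum2_sigS_sigD`, `sum2_sigD_sigD`, `sum2_sigB_sigB`, `sum2_ctr_sigB`, `sum2_sigB_ctr`, `sum2_ctr_ctr`, `sum2_sigO_sigO`,
**`abs_graphAmp_le_ampE_signed`**; FILE 1's `outSlots`; FILE 2's `basisV`; r15's `B3Prop1.VertexKind.isAveragingVertex`; FILE 18 `B3Ineq213TorusBlocks`: `baseBlock`, `relBox`, `relBox_baseBlock_lt_half`,
`injOn_pts_relBox`, `exists_pts_relBox_of_mem_blockK`, `lineBounds_basedChart_of_torus`, `torusTreeLen`, `exp_boxTreeLen_relBox_le`;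
FILE 12 `B3GraphAmplitudePositionForm`: `uOfKind`, `Lines`, `lineSrc`, `lineTgt`, `extAt`, `ampOf`, `modelOfGraph`; FILE 17
`B3Eq213TorusBoxSeam`: `labelChartAt`, `blockCorner`, `eps_setupAt`, `spacing_setupAt`; FILE 15 `B3DifferentiatedLineKernels`:
`abs_dK1_zero_free_le`, `abs_dK2_zero_free_le`, `abs_dKs_zero_free_le`; FILE 16 `B3Ineq210ZeroHiggsTorus`: `gpieceH`,
`gpieceH_bounds_model`, `gpieceH_mixed_bound_model`, `dKernelL_mesh0`, `dKernelR_mesh0`, `d2KernelT_mesh0`, `abs_freeKernel_le`; FILE 6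
`B3Eq326FromFeynmanRules`: `dK1`, `dK2`, `dKernelL`, `dKernelR`, `d2KernelT`; FILE 5 `B3Eq39FromFeynmanRules.dKs`; p19's
`B3Ineq213.{Amp, Amp.E, Amp.abs_E_le, pts, supDist, LinesConnect, boxTreeLen}`; gen-2's `B3Ineq215.{Model, Model.sc, Model.Mon, Model.W,
Model.W_nonneg, Cube}`; r15's `B3Prop1.VertexKind` (+ `scalarLegs`); p14's `B1Eq211ZeroFieldTorus.Shape`, `B1Eq211ZeroFieldTorusLevels.setupAt`;
the typer's `HiggsLattice.{Params, Params.mesh, Site, Site.tdist, PBond}`; `HiggsAveraging.blockK`.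

THE PRINTED TEXT (verbatim, p. 426 [PDF 16]).  *"We estimate it taking absolute values of all factors. … For the propagators G^η_{(j)}
we apply the inequality |G^η_{(j)}(Ω, B̃; x, x′)| ≦ O(1)(L^jη)^{−d+2}e^{−δ₁(L^jη)^{−1}|x−x′|}, (2.10) and if the propagator is
differentiated, then for each differentiation, there is an additional factor (L^jη)^{−1} on the right side. … After all these
operations we get the following inequality: |Σ_{j∈J(l̃)} E(G(j), {□(v)}_{v∈G}, Φ′_ext, A_ext)| ≦ O(1)(e(L^kε))^{d_v(G)}(λ(L^kε))^{d_s(G)}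
exp[−(δ₁/2)d({□(v)}_{v∈G})] ‖hΦ_ext‖₁‖h′A_ext‖₁ Σ_{j∈J(l̃)} Ẽ(G(j), {□(v)}_{v∈G}), (2.13)"*.

WHY THIS FILE ∕ READING (declared).  (§1) FILE 18 put FILE 12 §7's `abs_graphAmp_le_ampE` (vertex functions `uOfKind`, for graphs
without differentiated φ′-legs) on the torus for block-localized graphs anywhere on `T_η`; this file does the same for FILE 14's SIGNED
form `abs_graphAmp_le_ampE_signed` — valid for ALL graphs of p18's model, each differentiation booked on its LINE (p19's `a_l` carries
print's `−1` per differentiation, the vertex functions `UOf` carry no `η⁻¹`): **`abs_graphAmp_le_ampE_signed_torusBlocks`**, composed with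
p19's PROVED (2.13) `Amp.abs_E_le` (**`abs_graphAmp_le_ineq213_signed_torusBlocks`**) and with FILE 18 §3's torus tree length
(**`abs_graphAmp_le_ineq213_signed_torus`**).  (§2–§3) FILE 14's scalar-line hypothesis `hKs` asks, for every line and every pair of
LABELS of its endpoints, a bound on the signed effective kernel `Σ_{p,p′} σσ′K` by a position kernel; by FILE 14 §2 that effective kernel is
the ENTRY, `dK1`, `dK2` or `dKs` of the line's propagator according to which of the two legs is differentiated.  Here this is made a
DISPATCH: the per-kind signed attachment `sigSK M κ j ξ` of FILE 14 is, for every kind `κ`, leg `j` and label `ξ`, EITHER identically zero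
(label of the wrong shape), OR `sigS` at the label's position with some channel (undifferentiated leg: `isDiffLeg κ j = false`), OR `sigD` at
the label's bond with some channel (the differentiated leg `0` of (1.8)/(1.9): `isDiffLeg κ j = true`) — **`sigSK_trichotomy`**; hence from
FOUR position bounds `B₀₀ ≥ |entry|`, `B₁₀ ≥ |dK1|`, `B₀₁ ≥ |dK2|`, `B₁₁ ≥ |dKs|` the hypothesis `hKs` holds with the bound SELECTED BY THE
DIFFERENTIATION PATTERN of the line's two legs (**`abs_sum2_sigSK_le_of_pattern`**, `lineBoundOfPattern`) — print's *"for each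
differentiation, there is an additional factor (L^jη)^{−1}"* as bookkeeping, any background.  (§4) At ZERO background (`B̃ = 0`) with the FREE
kernel `G ⊗ 1_N` of a scalar line, FILE 15 turns the four objects into `G`, `∂^ηG`, `G∂^{η*}`, `∂^ηG∂^{η*}` (FILE 6's `dKernelL` ∕ `dKernelR` ∕
`d2KernelT`): **`abs_sum2_sigSK_free_zero_le`**.  (§5) The same dispatch for the other two line species of FILE 14: the A′-leg attachment
`sigVK` is zero ∕ the bond delta `sigB` (bond vertices (1.8)–(1.11)) ∕ the contour functional `ctr(δ_β)(x)` (averaging vertices (1.14), (1.15))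
— **`sigVK_trichotomy`** — so `hKv` follows from bounds on the entry, the singly and the doubly contour-averaged vector kernel selected by
`isAveragingVertex` of the two endpoint kinds (**`abs_sum2_sigVK_le_of_pattern`**; print's (2.12) *"For each such expression we have an
additional factor L^jη"* as a selector; the bounds themselves — rows B3.Eq2.10 ∕ 2.12 — stay hypotheses); the output attachment `sigOK` is
zero ∕ `sigO` at the block point of the position (**`sigOK_dichotomy`**), so `hKo` follows from an entry bound of the (1.18) kernel at block
points (**`abs_sum2_sigOK_le`**).  (§6) THE TREE'S (2.10) FED IN: for `G = G^η_{(j)}(T_η, 0)` = FILE 16's `gpieceH_j` at the model's step-`k`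
data, FILE 16's `gpieceH_bounds_model` (value, one differentiation at either end) and `gpieceH_mixed_bound_model` (one at each end) merged
to one pair `δ₁, C` (**`gpieceH_four_bounds`**) give the four bounds in the printed torus shape, whence **`hKs_scalarLine_zero_free`**: at
zero background every scalar line carrying the free piece `G^η_{(j)} ⊗ 1_N` satisfies FILE 14's `hKs` with the TORUS-shape kernel
`C·(L^kε)^{−n}·(L^jη)^{2−d−n}·exp[−2δ₀(L^jη)^{−1}(η·tdist)]`, `n` = the number of differentiated legs of the line — exactly the shape `hKT`
of §1 ∕ FILE 18 consumes (`a_l = 2 − d − n_l`, `δ₀ = δ₁∕2`, `C_l = C·(L^kε)^{−n_l}`), hypothesis-free.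

WHAT IS TYPED ∕ PROVED (definitions with bodies + theorems; no `Prop` fact, no `sorry`; standard axioms).
§1 `UOf_eq_zero_of_uOfKind_eq_zero`, **`abs_graphAmp_le_ampE_signed_torusBlocks`**, **`abs_graphAmp_le_ineq213_signed_torusBlocks`**,
**`abs_graphAmp_le_ineq213_signed_torus`**.  §2 `isDiffLeg` (+ `isDiffLeg_v18`, `isDiffLeg_v19`), `Lab.pos_inl`, `Lab.pos_inr`,
**`sigSK_trichotomy`**.  §3 `lineBoundOfPattern` (+ four `rfl` lemmas, `lineBoundOfPattern_nonneg`, `lineBoundOfPattern_count`),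
**`abs_sum2_sigSK_le_of_pattern`**.  §4 **`abs_sum2_sigSK_free_zero_le`**.  §5 **`sigVK_trichotomy`**, **`abs_sum2_sigVK_le_of_pattern`**,
`sigOK_dichotomy`, **`abs_sum2_sigOK_le`**.  §6 **`gpieceH_four_bounds`**, **`hKs_scalarLine_zero_free`**.  §7 (v1.1)
`abs_sum2_sigVK_le_of_bondLegs`, **`hKv_vectorLine_zero_free_bondLegs`** (the vector lines joining two bond vertices at zero background).
HONEST SCOPE.  (a) §1 is bookkeeping over FILE 14 + FILE 18, ANY background: the line bounds (torus shape), the contracted-attachment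
hypotheses, the external data and the vertex bounds stay hypotheses, as in p19's `Amp`; the ONLY geometric restriction is FILE 18's
configuration hypothesis (all blocks within torus distance `D` of one block `p`, `2D < L^{K−k}ML′_μ`), and print's `d({□(v)})` is FILE 18's
torus tree length (`abs_graphAmp_le_ineq213_signed_torus`, via FILE 18's `torusTreeLen_le_boxTreeLen_relBox`).  (b) WHICH BACKGROUNDS: §2, §3
and §5 (the dispatches `sigSK_trichotomy` ∕ `sigVK_trichotomy` ∕ `sigOK_dichotomy`, `abs_sum2_sigSK_le_of_pattern`, `abs_sum2_sigVK_le_of_pattern`,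
`abs_sum2_sigOK_le`) hold at a GENERAL background `B̃` — the kernel bounds (entry, `dK1`, `dK2`, `dKs` of the covariant scalar kernel; entry and
contour averages of the vector kernel; block-point entries of the (1.18) kernel) are hypotheses there, to be fed at a regular background by r14's
`B3Ineq210RegularTorus` ∕ p40's `B3Ineq210MixedRegularTorus` ∕ `B3Ineq211RegularTorus` through FILE 15's `abs_dK1_le`, by the (2.12) files
(`B3Ineq212RegularRegion`, `B3Ineq212VectorTorus`) and by row B3.Eq1.18 (not done here); §4 (`abs_sum2_sigSK_free_zero_le`) and §6 are the
ZERO-BACKGROUND instance ONLY (`B̃ = 0`, `U ≡ 1`; §6 moreover `Ω = T_η`, tori of p14's sub-family `M·L′_μ = L^m`, `L` odd, steps `1 ≤ k ≤ K`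
with `L^kε ≤ 1`, fixed `a > 0`, model mass `m² ≥ 0`; constants existential, functions of `d, L, a, m²`), for the SCALAR lines carrying the free
piece `gpieceH_j ⊗ 1_N`; which multiple of it a consumer's model puts on a line (`(L^kε)²·pieceH_j`, FILE 16's reading (c)) rescales `C`;
§7 (v1.1) is the same zero-background instance for the VECTOR lines both of whose legs sit in bond vertices ((1.8)–(1.11)), kernel
`[μ = μ′]·gpieceH_j(b₋, b′₋)` (the shape of FILE 16's `bondEntry_pieceA_zero`), value clause of (2.10) only (A′-legs are never differentiated).
(c) The BOUNDS for vector lines with a leg in an averaging vertex ((2.12)), output pairs ((1.18)), the external legs and the vertex bounds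
`u_le` are NOT discharged here (only dispatched, §5; `u_le` is FILE 20 `B3Ineq213VertexBounds`).
(d) The factor `(L^kε)^{−n}` in §5 is the model's mesh normalization of the difference quotients (`ε⁻¹ = (L^kε)⁻¹η⁻¹`, FILE 16 §4) — print
works in the rescaled frame `L^kε = 1`.  (e) Print never displays the dispatch; it is OUR reading of *"for each differentiation, there is an
additional factor"*, fixed so that FILE 14's hypothesis is met from the tree's (2.10).  Unit `lit-balaban-p26` gen 46
(literature-prover-lit-balaban-p26-g46-0), HOME `run/shared/lean/pub/lit-balaban/`, 2026-08-25.
-/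

open Finset
open scoped BigOperators

namespace Literature.MathematicalPhysics.QuantumFieldTheory.Balaban1983to89.B3Ineq213TorusBlocksSigned

open Literature.MathematicalPhysics.QuantumFieldTheory.Balaban1983to89.B3Cor23Concrete (Graph)
open Literature.MathematicalPhysics.QuantumFieldTheory.Balaban1983to89.B3GraphAmplitude
open Literature.MathematicalPhysics.QuantumFieldTheory.Balaban1983to89.B3GraphAmplitudeRules
open Literature.MathematicalPhysics.QuantumFieldTheory.Balaban1983to89.B3GraphAmplitudePositionForm
open Literature.MathematicalPhysics.QuantumFieldTheory.Balaban1983to89.B3GraphAmplitudeSignedPositionForm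
open Literature.MathematicalPhysics.QuantumFieldTheory.Balaban1983to89.B3Eq213TorusBoxSeam
open Literature.MathematicalPhysics.QuantumFieldTheory.Balaban1983to89.B3Ineq213TorusBlocks
open Literature.MathematicalPhysics.QuantumFieldTheory.Balaban1983to89.B3Ineq213
open Literature.MathematicalPhysics.QuantumFieldTheory.Balaban1983to89.B3Ineq215 (Cube)
open Literature.MathematicalPhysics.QuantumFieldTheory.Balaban1983to89.B3Prop1 (VertexKind)
open Literature.MathematicalPhysics.QuantumFieldTheory.Balaban1983to89.HiggsAveraging (blockIter blockK mem_blockK)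
open Literature.MathematicalPhysics.QuantumFieldTheory.Balaban1983to89.B3Eq326FromFeynmanRules (dK1 dK2 dKernelL dKernelR d2KernelT)
open Literature.MathematicalPhysics.QuantumFieldTheory.Balaban1983to89.B3Eq39FromFeynmanRules (dKs)

noncomputable section

/-! ## §1 The signed form on the torus: (2.13) for every block-localized graph of p18's model, (2.11) currency -/

section Signed

variable {P : HiggsLattice.Params} {N k nbar : ℕ} [DecidableEq (HiggsLattice.PBond P 0)]

/-- The signed vertex function `UOf` vanishes where FILE 12's `uOfKind` does (FILE 14's `UOf_le_uOfKind` and `UOf_nonneg`) — so block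
support stated for `uOfKind` (FILE 12 §8) serves the signed form. [cite: Balaban1983Higgs3, p.420] -/
theorem UOf_eq_zero_of_uOfKind_eq_zero (M : Model P N k) (dm2 : HiggsLattice.Site P 0 → ℝ) (l : Loc P k) (κ : VertexKind)
    {x : HiggsLattice.Site P 0} (h : uOfKind M dm2 l κ x = 0) : UOf M dm2 l κ x = 0 :=
  le_antisymm (by simpa [h] using UOf_le_uOfKind M dm2 l κ x) (UOf_nonneg M dm2 l κ x)

/-- **`|E(G, {B^k(y_v)}, Φ_ext, A_ext)| ≤ E_j` IN THE SIGNED CURRENCY, FOR A BLOCK-LOCALIZED GRAPH ANYWHERE ON THE TORUS** — FILE 14's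
`abs_graphAmp_le_ampE_signed` (ALL graphs of p18's model; the kernel families dominate the SIGNED effective kernels of the lines, so `a_l`
may carry print's `−1` per differentiation and the vertex functions `UOf` carry no `η⁻¹`) with the chart hypotheses discharged by FILE 18 §1
(based charts about `p − D`, relative boxes) and p19's `K_le` derived from TORUS-shape line bounds at all sites (`hKT`), for vertex functions
living in blocks `B^k(y_v)` all within torus distance `D` of a block `p`, `2D < L^{K−k}ML′_μ`. [cite: Balaban1983Higgs3, (2.13) p.426]
[cite: Balaban1983Higgs3, (2.11) p.426] [cite: Balaban1983Higgs3, p.420] [cite: Balaban1982Higgs1, (1.3) p.604] -/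
theorem abs_graphAmp_le_ampE_signed_torusBlocks (hK : k ≤ P.K) (hL2 : 2 ≤ P.L) (G : Graph nbar) (Mh : Model P N k)
    (dm2 : Fin G.nV → HiggsLattice.Site P 0 → ℝ) (loc : Fin G.nV → Loc P k) (Po : OutPairing G)
    (Ks : SLine G → HiggsLattice.Site P 0 × Fin N → HiggsLattice.Site P 0 × Fin N → ℝ)
    (Kv : VLine G → HiggsLattice.PBond P 0 → HiggsLattice.PBond P 0 → ℝ)
    (Ko : Po.Line oRank → HiggsLattice.Site P k × Fin N → HiggsLattice.Site P k × Fin N → ℝ)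
    (Φ : (ExtSLeg G → HiggsLattice.Site P 0 × Fin N) → ℝ) (A : (ExtVLeg G → HiggsLattice.PBond P 0) → ℝ)
    (Ψ : (Po.Ext → HiggsLattice.Site P k × Fin N) → ℝ)
    {m : ℕ} (eL : Fin m ≃ Lines G Po) (e : Fin G.nV → ℝ) (a : Fin m → ℝ) (δ₀ : ℝ) (hδ : 0 < δ₀) (j : Fin m → ℕ)
    (K : Fin m → ℕ → HiggsLattice.Site P 0 → HiggsLattice.Site P 0 → ℝ) (hK0 : ∀ i t x x', 0 ≤ K i t x x')
    (hKs : ∀ (l : SLine G) (ξ₁ ξ₂ : Lab P N),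
      |∑ p, ∑ p', sigSK Mh (G.kind l.1.1) l.1.2 ξ₁ p *
          sigSK Mh (G.kind ((sPairing G).mate l.1).1) ((sPairing G).mate l.1).2 ξ₂ p' * Ks l p p'| ≤
        K (eL.symm (Sum.inl l)) (j (eL.symm (Sum.inl l))) ξ₁.pos ξ₂.pos)
    (hKv : ∀ (l : VLine G) (ξ₁ ξ₂ : Lab P N),
      |∑ b, ∑ b', sigVK Mh (G.kind l.1.1) l.1.2 ξ₁ b *
          sigVK Mh (G.kind ((vPairing G).mate l.1).1) ((vPairing G).mate l.1).2 ξ₂ b' * Kv l b b'| ≤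
        K (eL.symm (Sum.inr (Sum.inl l))) (j (eL.symm (Sum.inr (Sum.inl l)))) ξ₁.pos ξ₂.pos)
    (hKo : ∀ (l : Po.Line oRank) (ξ₁ ξ₂ : Lab P N),
      |∑ r, ∑ r', sigOK k (G.kind l.1.1) l.1.2 ξ₁ r * sigOK k (G.kind (Po.mate l.1).1) (Po.mate l.1).2 ξ₂ r' * Ko l r r'| ≤
        K (eL.symm (Sum.inr (Sum.inr l))) (j (eL.symm (Sum.inr (Sum.inr l)))) ξ₁.pos ξ₂.pos)
    (nS : ExtSLeg G → HiggsLattice.Site P 0 → ℝ) (hnS0 : ∀ e x, 0 ≤ nS e x)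
    (hΦ : ∀ ξ : Fin G.nV → Lab P N,
      |∑ γ : ExtSLeg G → HiggsLattice.Site P 0 × Fin N, (∏ e : ExtSLeg G, sigSK Mh (G.kind e.1.1) e.1.2 (ξ e.1.1) (γ e)) * Φ γ| ≤
        ∏ e : ExtSLeg G, nS e (ξ e.1.1).pos)
    (nV : ExtVLeg G → HiggsLattice.Site P 0 → ℝ) (hnV0 : ∀ e x, 0 ≤ nV e x)
    (hA : ∀ ξ : Fin G.nV → Lab P N,
      |∑ ζ : ExtVLeg G → HiggsLattice.PBond P 0, (∏ e : ExtVLeg G, sigVK Mh (G.kind e.1.1) e.1.2 (ξ e.1.1) (ζ e)) * A ζ| ≤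
        ∏ e : ExtVLeg G, nV e (ξ e.1.1).pos)
    (nO : Po.Ext → HiggsLattice.Site P 0 → ℝ) (hnO0 : ∀ e x, 0 ≤ nO e x)
    (hΨ : ∀ ξ : Fin G.nV → Lab P N,
      |∑ ο : Po.Ext → HiggsLattice.Site P k × Fin N, (∏ e : Po.Ext, sigOK k (G.kind e.1.1) e.1.2 (ξ e.1.1) (ο e)) * Ψ ο| ≤
        ∏ e : Po.Ext, nO e (ξ e.1.1).pos)
    (y : Fin G.nV → HiggsLattice.Site P k)
    (hloc : ∀ v x, x ∉ blockK k (y v) → uOfKind Mh (dm2 v) (loc v) (G.kind v) x = 0)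
    (p : HiggsLattice.Site P k) (D : ℕ) (hy : ∀ v, HiggsLattice.Site.tdist (y v) p ≤ D) (hD : ∀ μ, 2 * D < P.halfPerDir k μ)
    (C : Fin m → ℝ) (eRun lamRun : ℝ) (dv ds : Fin G.nV → ℕ) (NPhi NA : Fin G.nV → ℝ)
    (C_nonneg : ∀ l, 0 ≤ C l) (eRun_nonneg : 0 ≤ eRun) (lamRun_nonneg : 0 ≤ lamRun) (NPhi_nonneg : ∀ v, 0 ≤ NPhi v)
    (NA_nonneg : ∀ v, 0 ≤ NA v) (e_nonneg : ∀ v, 0 ≤ e v)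
    (conn : LinesConnect (fun i => lineSrc Po (eL i)) (fun i => lineTgt Po (eL i)))
    (u_le : ∀ v x, |((P.L : ℝ) ^ k) ^ P.d * (UOf Mh (dm2 v) (loc v) (G.kind v) x * extAt Po nS nV nO v x)| ≤
      eRun ^ dv v * lamRun ^ ds v * NPhi v * NA v * (((P.L : ℝ) ^ k)⁻¹) ^ e v)
    (hKT : ∀ l t, t < k → ∀ x x', |K l t x x'| ≤
      C l * (modelOfGraph G Po eL e a P.d P.L δ₀ P.hd hL2 hδ).sc k t ^ a l *
        Real.exp (-(2 * δ₀ / (modelOfGraph G Po eL e a P.d P.L δ₀ P.hd hL2 hδ).sc k t *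
          (((P.L : ℝ) ^ k)⁻¹ * (HiggsLattice.Site.tdist x x' : ℝ))))) :
    |graphAmp G Mh dm2 loc Po Ks Kv Ko Φ A Ψ| ≤
      (ampOf (modelOfGraph G Po eL e a P.d P.L δ₀ P.hd hL2 hδ) k (fun v => relBox (baseBlock p D) (y v))
        (fun _ => labelChartAt P 0 (blockCorner (baseBlock p D)))
        (fun v x => UOf Mh (dm2 v) (loc v) (G.kind v) x * extAt Po nS nV nO v x) K C eRun lamRun dv ds NPhi NA
        C_nonneg eRun_nonneg lamRun_nonneg NPhi_nonneg NA_nonneg e_nonneg conn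
        (fun v ξ => u_le v (labelChartAt P 0 (blockCorner (baseBlock p D)) ξ))
        (lineBounds_basedChart_of_torus hK (baseBlock p D) (y := y) (fun v μ => relBox_baseBlock_lt_half (hy v) hD μ)
          (modelOfGraph G Po eL e a P.d P.L δ₀ P.hd hL2 hδ).src (modelOfGraph G Po eL e a P.d P.L δ₀ P.hd hL2 hδ).tgt K C
          ((modelOfGraph G Po eL e a P.d P.L δ₀ P.hd hL2 hδ).sc k) a δ₀ (((P.L : ℝ) ^ k)⁻¹) hKT)).E j := by
  refine abs_graphAmp_le_ampE_signed G Mh dm2 loc Po Ks Kv Ko Φ A Ψ eL e a P.d P.L δ₀ P.hd hL2 hδ j K hK0 hKs hKv hKo nS hnS0 hΦ nV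
    hnV0 hA nO hnO0 hΨ k (fun v => relBox (baseBlock p D) (y v)) (fun _ => labelChartAt P 0 (blockCorner (baseBlock p D)))
    (fun v => injOn_pts_relBox hK (baseBlock p D) (y v)) (fun v x hx => ?_) C eRun lamRun dv ds NPhi NA C_nonneg eRun_nonneg
    lamRun_nonneg NPhi_nonneg NA_nonneg e_nonneg conn _ _
  -- support: off `B^k(y_v)` the signed vertex function vanishes with FILE 12's
  refine exists_pts_relBox_of_mem_blockK hK (baseBlock p D) (y v) ?_
  by_contra hxB
  exact hx (by rw [UOf_eq_zero_of_uOfKind_eq_zero Mh (dm2 v) (loc v) (G.kind v) (hloc v x hxB), zero_mul])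

/-- **(2.13) IN THE SIGNED CURRENCY FOR A BLOCK-LOCALIZED GRAPH ANYWHERE ON `T_η`** — composed with p19's PROVED `Amp.abs_E_le`: for
`j ∈ J(l̃)`, `|E(G(j), {B^k(y_v)}, Φ′_ext, A_ext)| ≤ (Π_l C_l)·e^{d_v(G)}λ^{d_s(G)}·exp[−δ₀·boxTreeLen(relative boxes)]·(Π N^Φ_v)(Π N^A_v)·W`,
`W` = gen-2's weight sum (2.14) with print's line dimensions. [cite: Balaban1983Higgs3, (2.13) p.426] [cite: Balaban1983Higgs3, (2.14) p.427] -/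
theorem abs_graphAmp_le_ineq213_signed_torusBlocks (hK : k ≤ P.K) (hL2 : 2 ≤ P.L) (G : Graph nbar) (Mh : Model P N k)
    (dm2 : Fin G.nV → HiggsLattice.Site P 0 → ℝ) (loc : Fin G.nV → Loc P k) (Po : OutPairing G)
    (Ks : SLine G → HiggsLattice.Site P 0 × Fin N → HiggsLattice.Site P 0 × Fin N → ℝ)
    (Kv : VLine G → HiggsLattice.PBond P 0 → HiggsLattice.PBond P 0 → ℝ)
    (Ko : Po.Line oRank → HiggsLattice.Site P k × Fin N → HiggsLattice.Site P k × Fin N → ℝ)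
    (Φ : (ExtSLeg G → HiggsLattice.Site P 0 × Fin N) → ℝ) (A : (ExtVLeg G → HiggsLattice.PBond P 0) → ℝ)
    (Ψ : (Po.Ext → HiggsLattice.Site P k × Fin N) → ℝ)
    {m : ℕ} (eL : Fin m ≃ Lines G Po) (e : Fin G.nV → ℝ) (a : Fin m → ℝ) (δ₀ : ℝ) (hδ : 0 < δ₀) {j : Fin m → ℕ}
    (hj : j ∈ B3Ineq215.Model.Mon m k)
    (K : Fin m → ℕ → HiggsLattice.Site P 0 → HiggsLattice.Site P 0 → ℝ) (hK0 : ∀ i t x x', 0 ≤ K i t x x')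
    (hKs : ∀ (l : SLine G) (ξ₁ ξ₂ : Lab P N),
      |∑ p, ∑ p', sigSK Mh (G.kind l.1.1) l.1.2 ξ₁ p *
          sigSK Mh (G.kind ((sPairing G).mate l.1).1) ((sPairing G).mate l.1).2 ξ₂ p' * Ks l p p'| ≤
        K (eL.symm (Sum.inl l)) (j (eL.symm (Sum.inl l))) ξ₁.pos ξ₂.pos)
    (hKv : ∀ (l : VLine G) (ξ₁ ξ₂ : Lab P N),
      |∑ b, ∑ b', sigVK Mh (G.kind l.1.1) l.1.2 ξ₁ b *
          sigVK Mh (G.kind ((vPairing G).mate l.1).1) ((vPairing G).mate l.1).2 ξ₂ b' * Kv l b b'| ≤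
        K (eL.symm (Sum.inr (Sum.inl l))) (j (eL.symm (Sum.inr (Sum.inl l)))) ξ₁.pos ξ₂.pos)
    (hKo : ∀ (l : Po.Line oRank) (ξ₁ ξ₂ : Lab P N),
      |∑ r, ∑ r', sigOK k (G.kind l.1.1) l.1.2 ξ₁ r * sigOK k (G.kind (Po.mate l.1).1) (Po.mate l.1).2 ξ₂ r' * Ko l r r'| ≤
        K (eL.symm (Sum.inr (Sum.inr l))) (j (eL.symm (Sum.inr (Sum.inr l)))) ξ₁.pos ξ₂.pos)
    (nS : ExtSLeg G → HiggsLattice.Site P 0 → ℝ) (hnS0 : ∀ e x, 0 ≤ nS e x)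
    (hΦ : ∀ ξ : Fin G.nV → Lab P N,
      |∑ γ : ExtSLeg G → HiggsLattice.Site P 0 × Fin N, (∏ e : ExtSLeg G, sigSK Mh (G.kind e.1.1) e.1.2 (ξ e.1.1) (γ e)) * Φ γ| ≤
        ∏ e : ExtSLeg G, nS e (ξ e.1.1).pos)
    (nV : ExtVLeg G → HiggsLattice.Site P 0 → ℝ) (hnV0 : ∀ e x, 0 ≤ nV e x)
    (hA : ∀ ξ : Fin G.nV → Lab P N,
      |∑ ζ : ExtVLeg G → HiggsLattice.PBond P 0, (∏ e : ExtVLeg G, sigVK Mh (G.kind e.1.1) e.1.2 (ξ e.1.1) (ζ e)) * A ζ| ≤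
        ∏ e : ExtVLeg G, nV e (ξ e.1.1).pos)
    (nO : Po.Ext → HiggsLattice.Site P 0 → ℝ) (hnO0 : ∀ e x, 0 ≤ nO e x)
    (hΨ : ∀ ξ : Fin G.nV → Lab P N,
      |∑ ο : Po.Ext → HiggsLattice.Site P k × Fin N, (∏ e : Po.Ext, sigOK k (G.kind e.1.1) e.1.2 (ξ e.1.1) (ο e)) * Ψ ο| ≤
        ∏ e : Po.Ext, nO e (ξ e.1.1).pos)
    (y : Fin G.nV → HiggsLattice.Site P k)
    (hloc : ∀ v x, x ∉ blockK k (y v) → uOfKind Mh (dm2 v) (loc v) (G.kind v) x = 0)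
    (p : HiggsLattice.Site P k) (D : ℕ) (hy : ∀ v, HiggsLattice.Site.tdist (y v) p ≤ D) (hD : ∀ μ, 2 * D < P.halfPerDir k μ)
    (C : Fin m → ℝ) (eRun lamRun : ℝ) (dv ds : Fin G.nV → ℕ) (NPhi NA : Fin G.nV → ℝ)
    (C_nonneg : ∀ l, 0 ≤ C l) (eRun_nonneg : 0 ≤ eRun) (lamRun_nonneg : 0 ≤ lamRun) (NPhi_nonneg : ∀ v, 0 ≤ NPhi v)
    (NA_nonneg : ∀ v, 0 ≤ NA v) (e_nonneg : ∀ v, 0 ≤ e v)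
    (conn : LinesConnect (fun i => lineSrc Po (eL i)) (fun i => lineTgt Po (eL i)))
    (u_le : ∀ v x, |((P.L : ℝ) ^ k) ^ P.d * (UOf Mh (dm2 v) (loc v) (G.kind v) x * extAt Po nS nV nO v x)| ≤
      eRun ^ dv v * lamRun ^ ds v * NPhi v * NA v * (((P.L : ℝ) ^ k)⁻¹) ^ e v)
    (hKT : ∀ l t, t < k → ∀ x x', |K l t x x'| ≤
      C l * (modelOfGraph G Po eL e a P.d P.L δ₀ P.hd hL2 hδ).sc k t ^ a l *
        Real.exp (-(2 * δ₀ / (modelOfGraph G Po eL e a P.d P.L δ₀ P.hd hL2 hδ).sc k t *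
          (((P.L : ℝ) ^ k)⁻¹ * (HiggsLattice.Site.tdist x x' : ℝ))))) :
    |graphAmp G Mh dm2 loc Po Ks Kv Ko Φ A Ψ| ≤
      (∏ l, C l) *
        (eRun ^ (∑ v, dv v) * lamRun ^ (∑ v, ds v) *
            Real.exp (-(δ₀ * boxTreeLen P.L k (fun v => relBox (baseBlock p D) (y v)))) * (∏ v, NPhi v) * ∏ v, NA v) *
        (modelOfGraph G Po eL e a P.d P.L δ₀ P.hd hL2 hδ).W 0 k j (fun v => relBox (baseBlock p D) (y v)) := by
  have h1 := abs_graphAmp_le_ampE_signed_torusBlocks hK hL2 G Mh dm2 loc Po Ks Kv Ko Φ A Ψ eL e a δ₀ hδ j K hK0 hKs hKv hKo nS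
    hnS0 hΦ nV hnV0 hA nO hnO0 hΨ y hloc p D hy hD C eRun lamRun dv ds NPhi NA C_nonneg eRun_nonneg lamRun_nonneg NPhi_nonneg
    NA_nonneg e_nonneg conn u_le hKT
  refine h1.trans ((le_abs_self _).trans ?_)
  exact Amp.abs_E_le _ hj

/-- **(2.13) IN THE SIGNED CURRENCY WITH PRINT'S TORUS TREE LENGTH `d({□(v)}_{v∈G})`** (FILE 18 §3's `torusTreeLen`).
[cite: Balaban1983Higgs3, (2.13) p.426] [cite: Balaban1983Higgs3, (1.33) p.420] [cite: Balaban1982Higgs1, (1.3) p.604] -/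
theorem abs_graphAmp_le_ineq213_signed_torus (hK : k ≤ P.K) (hL2 : 2 ≤ P.L) (G : Graph nbar) (Mh : Model P N k)
    (dm2 : Fin G.nV → HiggsLattice.Site P 0 → ℝ) (loc : Fin G.nV → Loc P k) (Po : OutPairing G)
    (Ks : SLine G → HiggsLattice.Site P 0 × Fin N → HiggsLattice.Site P 0 × Fin N → ℝ)
    (Kv : VLine G → HiggsLattice.PBond P 0 → HiggsLattice.PBond P 0 → ℝ)
    (Ko : Po.Line oRank → HiggsLattice.Site P k × Fin N → HiggsLattice.Site P k × Fin N → ℝ)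
    (Φ : (ExtSLeg G → HiggsLattice.Site P 0 × Fin N) → ℝ) (A : (ExtVLeg G → HiggsLattice.PBond P 0) → ℝ)
    (Ψ : (Po.Ext → HiggsLattice.Site P k × Fin N) → ℝ)
    {m : ℕ} (eL : Fin m ≃ Lines G Po) (e : Fin G.nV → ℝ) (a : Fin m → ℝ) (δ₀ : ℝ) (hδ : 0 < δ₀) {j : Fin m → ℕ}
    (hj : j ∈ B3Ineq215.Model.Mon m k)
    (K : Fin m → ℕ → HiggsLattice.Site P 0 → HiggsLattice.Site P 0 → ℝ) (hK0 : ∀ i t x x', 0 ≤ K i t x x')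
    (hKs : ∀ (l : SLine G) (ξ₁ ξ₂ : Lab P N),
      |∑ p, ∑ p', sigSK Mh (G.kind l.1.1) l.1.2 ξ₁ p *
          sigSK Mh (G.kind ((sPairing G).mate l.1).1) ((sPairing G).mate l.1).2 ξ₂ p' * Ks l p p'| ≤
        K (eL.symm (Sum.inl l)) (j (eL.symm (Sum.inl l))) ξ₁.pos ξ₂.pos)
    (hKv : ∀ (l : VLine G) (ξ₁ ξ₂ : Lab P N),
      |∑ b, ∑ b', sigVK Mh (G.kind l.1.1) l.1.2 ξ₁ b *
          sigVK Mh (G.kind ((vPairing G).mate l.1).1) ((vPairing G).mate l.1).2 ξ₂ b' * Kv l b b'| ≤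
        K (eL.symm (Sum.inr (Sum.inl l))) (j (eL.symm (Sum.inr (Sum.inl l)))) ξ₁.pos ξ₂.pos)
    (hKo : ∀ (l : Po.Line oRank) (ξ₁ ξ₂ : Lab P N),
      |∑ r, ∑ r', sigOK k (G.kind l.1.1) l.1.2 ξ₁ r * sigOK k (G.kind (Po.mate l.1).1) (Po.mate l.1).2 ξ₂ r' * Ko l r r'| ≤
        K (eL.symm (Sum.inr (Sum.inr l))) (j (eL.symm (Sum.inr (Sum.inr l)))) ξ₁.pos ξ₂.pos)
    (nS : ExtSLeg G → HiggsLattice.Site P 0 → ℝ) (hnS0 : ∀ e x, 0 ≤ nS e x)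
    (hΦ : ∀ ξ : Fin G.nV → Lab P N,
      |∑ γ : ExtSLeg G → HiggsLattice.Site P 0 × Fin N, (∏ e : ExtSLeg G, sigSK Mh (G.kind e.1.1) e.1.2 (ξ e.1.1) (γ e)) * Φ γ| ≤
        ∏ e : ExtSLeg G, nS e (ξ e.1.1).pos)
    (nV : ExtVLeg G → HiggsLattice.Site P 0 → ℝ) (hnV0 : ∀ e x, 0 ≤ nV e x)
    (hA : ∀ ξ : Fin G.nV → Lab P N,
      |∑ ζ : ExtVLeg G → HiggsLattice.PBond P 0, (∏ e : ExtVLeg G, sigVK Mh (G.kind e.1.1) e.1.2 (ξ e.1.1) (ζ e)) * A ζ| ≤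
        ∏ e : ExtVLeg G, nV e (ξ e.1.1).pos)
    (nO : Po.Ext → HiggsLattice.Site P 0 → ℝ) (hnO0 : ∀ e x, 0 ≤ nO e x)
    (hΨ : ∀ ξ : Fin G.nV → Lab P N,
      |∑ ο : Po.Ext → HiggsLattice.Site P k × Fin N, (∏ e : Po.Ext, sigOK k (G.kind e.1.1) e.1.2 (ξ e.1.1) (ο e)) * Ψ ο| ≤
        ∏ e : Po.Ext, nO e (ξ e.1.1).pos)
    (y : Fin G.nV → HiggsLattice.Site P k)
    (hloc : ∀ v x, x ∉ blockK k (y v) → uOfKind Mh (dm2 v) (loc v) (G.kind v) x = 0)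
    (p : HiggsLattice.Site P k) (D : ℕ) (hy : ∀ v, HiggsLattice.Site.tdist (y v) p ≤ D) (hD : ∀ μ, 2 * D < P.halfPerDir k μ)
    (C : Fin m → ℝ) (eRun lamRun : ℝ) (dv ds : Fin G.nV → ℕ) (NPhi NA : Fin G.nV → ℝ)
    (C_nonneg : ∀ l, 0 ≤ C l) (eRun_nonneg : 0 ≤ eRun) (lamRun_nonneg : 0 ≤ lamRun) (NPhi_nonneg : ∀ v, 0 ≤ NPhi v)
    (NA_nonneg : ∀ v, 0 ≤ NA v) (e_nonneg : ∀ v, 0 ≤ e v)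
    (conn : LinesConnect (fun i => lineSrc Po (eL i)) (fun i => lineTgt Po (eL i)))
    (u_le : ∀ v x, |((P.L : ℝ) ^ k) ^ P.d * (UOf Mh (dm2 v) (loc v) (G.kind v) x * extAt Po nS nV nO v x)| ≤
      eRun ^ dv v * lamRun ^ ds v * NPhi v * NA v * (((P.L : ℝ) ^ k)⁻¹) ^ e v)
    (hKT : ∀ l t, t < k → ∀ x x', |K l t x x'| ≤
      C l * (modelOfGraph G Po eL e a P.d P.L δ₀ P.hd hL2 hδ).sc k t ^ a l *
        Real.exp (-(2 * δ₀ / (modelOfGraph G Po eL e a P.d P.L δ₀ P.hd hL2 hδ).sc k t *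
          (((P.L : ℝ) ^ k)⁻¹ * (HiggsLattice.Site.tdist x x' : ℝ))))) :
    |graphAmp G Mh dm2 loc Po Ks Kv Ko Φ A Ψ| ≤
      (∏ l, C l) *
        (eRun ^ (∑ v, dv v) * lamRun ^ (∑ v, ds v) * Real.exp (-(δ₀ * torusTreeLen k y)) * (∏ v, NPhi v) * ∏ v, NA v) *
        (modelOfGraph G Po eL e a P.d P.L δ₀ P.hd hL2 hδ).W 0 k j (fun v => relBox (baseBlock p D) (y v)) := by
  have h1 := abs_graphAmp_le_ineq213_signed_torusBlocks hK hL2 G Mh dm2 loc Po Ks Kv Ko Φ A Ψ eL e a δ₀ hδ hj K hK0 hKs hKv hKo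
    nS hnS0 hΦ nV hnV0 hA nO hnO0 hΨ y hloc p D hy hD C eRun lamRun dv ds NPhi NA C_nonneg eRun_nonneg lamRun_nonneg NPhi_nonneg
    NA_nonneg e_nonneg conn u_le hKT
  refine h1.trans ?_
  have hC : 0 ≤ ∏ l, C l := Finset.prod_nonneg fun l _ => C_nonneg l
  have hW : 0 ≤ (modelOfGraph G Po eL e a P.d P.L δ₀ P.hd hL2 hδ).W 0 k j (fun v => relBox (baseBlock p D) (y v)) :=
    B3Ineq215.Model.W_nonneg _ 0 k j _
  have hNPhi : 0 ≤ ∏ v, NPhi v := Finset.prod_nonneg fun v _ => NPhi_nonneg v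
  have hNA : 0 ≤ ∏ v, NA v := Finset.prod_nonneg fun v _ => NA_nonneg v
  have hel : 0 ≤ eRun ^ (∑ v, dv v) * lamRun ^ (∑ v, ds v) :=
    mul_nonneg (pow_nonneg eRun_nonneg _) (pow_nonneg lamRun_nonneg _)
  have hexp := exp_boxTreeLen_relBox_le hK (baseBlock p D) y hδ.le
  refine mul_le_mul_of_nonneg_right (mul_le_mul_of_nonneg_left ?_ hC) hW
  refine mul_le_mul_of_nonneg_right (mul_le_mul_of_nonneg_right ?_ hNPhi) hNA
  exact mul_le_mul_of_nonneg_left hexp hel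

end Signed

/-! ## §2 The differentiation pattern of a leg and the three shapes of the signed attachment `sigSK` -/

section Pattern

variable {P : HiggsLattice.Params} {N k : ℕ}

/-- **Is the `j`-th φ′-leg of a vertex of kind `κ` DIFFERENTIATED?** — exactly the leg `0` of (1.8)_{n,n′} and of its R-vertex (1.9)
(the leg carrying `D^η_{B̃}` in print's (1.8); FILE 14's `sigSK` attaches it by `sigD`). [cite: Balaban1983Higgs3, (1.8) p.413]
[cite: Balaban1983Higgs3, (1.9) p.413] -/
def isDiffLeg : (κ : VertexKind) → Fin κ.scalarLegs → Bool
  | .v18 _ _, j => decide (j.val = 0)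
  | .v19 _ _, j => decide (j.val = 0)
  | _, _ => false

/-- The differentiated leg of (1.8). [cite: Balaban1983Higgs3, (1.8) p.413] -/
theorem isDiffLeg_v18 (n n' : ℕ) (j : Fin (VertexKind.v18 n n').scalarLegs) : isDiffLeg (.v18 n n') j = decide (j.val = 0) := rfl

/-- The differentiated leg of (1.9). [cite: Balaban1983Higgs3, (1.9) p.413] -/
theorem isDiffLeg_v19 (n nb : ℕ) (j : Fin (VertexKind.v19 n nb).scalarLegs) : isDiffLeg (.v19 n nb) j = decide (j.val = 0) := rfl

/-- The position of a site label. [cite: Balaban1983Higgs3, p.426] -/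
theorem Lab.pos_inl (x : HiggsLattice.Site P 0) (c c' : Fin N) : Lab.pos ((Sum.inl x, c, c') : Lab P N) = x := rfl

/-- The position of a bond label is the initial point of the bond. [cite: Balaban1983Higgs3, p.426] -/
theorem Lab.pos_inr (b : HiggsLattice.PBond P 0) (c c' : Fin N) : Lab.pos ((Sum.inr b, c, c') : Lab P N) = b.src := rfl

/-- **THE THREE SHAPES OF FILE 14's SIGNED ATTACHMENT `sigSK M κ j ξ`** (all nine kinds): it is EITHER identically zero (a label of the wrong
shape for the kind), OR — for an undifferentiated leg, `isDiffLeg κ j = false` — the delta attachment `sigS` at the label's POSITION with some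
channel, OR — for the differentiated leg, `isDiffLeg κ j = true` — the signed difference-quotient attachment `sigD` at the label's BOND `b`
(whose initial point is the label's position) with some channel. [cite: Balaban1983Higgs3, (1.6)–(1.15) pp.413–414]
[cite: Balaban1983Higgs3, (2.11) p.426] -/
theorem sigSK_trichotomy (M : Model P N k) (κ : VertexKind) (j : Fin κ.scalarLegs) (ξ : Lab P N) :
    (sigSK M κ j ξ = fun _ => 0) ∨
      (isDiffLeg κ j = false ∧ ∃ c : Fin N, sigSK M κ j ξ = sigS ξ.pos c) ∨
      (isDiffLeg κ j = true ∧ ∃ (b : HiggsLattice.PBond P 0) (c : Fin N), ξ.pos = b.src ∧ sigSK M κ j ξ = sigD M.C M.B b c) := by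
  obtain ⟨s, c, c'⟩ := ξ
  cases κ with
  | v16 =>
    rcases s with x | b
    · refine Or.inr (Or.inl ⟨rfl, ?_⟩)
      by_cases h : j.val < 2
      · exact ⟨c, funext fun q => by simp [sigSK, h, Lab.pos]⟩
      · exact ⟨c', funext fun q => by simp [sigSK, h, Lab.pos]⟩
    · exact Or.inl (funext fun q => by simp [sigSK])
  | v17 =>
    rcases s with x | b
    · refine Or.inr (Or.inl ⟨rfl, ?_⟩)
      by_cases h : j.val = 0
      · exact ⟨c, funext fun q => by simp [sigSK, h, Lab.pos]⟩
      · exact ⟨c', funext fun q => by simp [sigSK, h, Lab.pos]⟩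
    · exact Or.inl (funext fun q => by simp [sigSK])
  | v18 n n' =>
    rcases s with x | b
    · exact Or.inl (funext fun q => by simp [sigSK])
    · by_cases h : j.val = 0
      · exact Or.inr (Or.inr ⟨by simp [isDiffLeg, h], b, c, rfl, funext fun q => by simp [sigSK, h]⟩)
      · exact Or.inr (Or.inl ⟨by simp [isDiffLeg, h], c', funext fun q => by simp [sigSK, h, Lab.pos]⟩)
  | v19 n nb =>
    rcases s with x | b
    · exact Or.inl (funext fun q => by simp [sigSK])
    · by_cases h : j.val = 0
      · exact Or.inr (Or.inr ⟨by simp [isDiffLeg, h], b, c, rfl, funext fun q => by simp [sigSK, h]⟩)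
      · exact Or.inr (Or.inl ⟨by simp [isDiffLeg, h], c', funext fun q => by simp [sigSK, h, Lab.pos]⟩)
  | v110 n n' =>
    rcases s with x | b
    · exact Or.inl (funext fun q => by simp [sigSK])
    · refine Or.inr (Or.inl ⟨rfl, ?_⟩)
      by_cases h : j.val = 0
      · exact ⟨c, funext fun q => by simp [sigSK, h, Lab.pos]⟩
      · exact ⟨c', funext fun q => by simp [sigSK, h, Lab.pos]⟩
  | v111 n nb =>
    rcases s with x | b
    · exact Or.inl (funext fun q => by simp [sigSK])
    · refine Or.inr (Or.inl ⟨rfl, ?_⟩)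
      by_cases h : j.val = 0
      · exact ⟨c, funext fun q => by simp [sigSK, h, Lab.pos]⟩
      · exact ⟨c', funext fun q => by simp [sigSK, h, Lab.pos]⟩
  | v113 =>
    rcases s with x | b
    · exact Or.inr (Or.inl ⟨rfl, c, funext fun q => by simp [sigSK, Lab.pos]⟩)
    · exact Or.inl (funext fun q => by simp [sigSK])
  | v114 n n' =>
    rcases s with x | b
    · exact Or.inr (Or.inl ⟨rfl, c, funext fun q => by simp [sigSK, Lab.pos]⟩)
    · exact Or.inl (funext fun q => by simp [sigSK])
  | v115 n nb =>
    rcases s with x | b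
    · exact Or.inr (Or.inl ⟨rfl, c, funext fun q => by simp [sigSK, Lab.pos]⟩)
    · exact Or.inl (funext fun q => by simp [sigSK])

end Pattern

/-! ## §3 FILE 14's scalar-line hypothesis from four position bounds, selected by the differentiation pattern of the line -/

section Dispatch

variable {P : HiggsLattice.Params} {N k : ℕ} {X : Type*}

/-- **The line bound selected by the differentiation pattern** of the two legs of a line: `B₀₀` (no leg differentiated: the entry),
`B₁₀` (first leg: `dK1`), `B₀₁` (second leg: `dK2`), `B₁₁` (both: `dKs`) — print's *"for each differentiation, there is an additional factor
(L^jη)^{−1} on the right side"* as a selector. [cite: Balaban1983Higgs3, (2.10) p.426] [cite: Balaban1983Higgs3, (2.11) p.426] -/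
def lineBoundOfPattern (d₁ d₂ : Bool) (B₀₀ B₁₀ B₀₁ B₁₁ : X → X → ℝ) : X → X → ℝ :=
  match d₁, d₂ with
  | false, false => B₀₀
  | true, false => B₁₀
  | false, true => B₀₁
  | true, true => B₁₁

/-- No leg differentiated: the entry bound. [cite: Balaban1983Higgs3, (2.10) p.426] -/
theorem lineBoundOfPattern_ff (B₀₀ B₁₀ B₀₁ B₁₁ : X → X → ℝ) : lineBoundOfPattern false false B₀₀ B₁₀ B₀₁ B₁₁ = B₀₀ := rfl

/-- First leg differentiated. [cite: Balaban1983Higgs3, (2.11) p.426] -/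
theorem lineBoundOfPattern_tf (B₀₀ B₁₀ B₀₁ B₁₁ : X → X → ℝ) : lineBoundOfPattern true false B₀₀ B₁₀ B₀₁ B₁₁ = B₁₀ := rfl

/-- Second leg differentiated. [cite: Balaban1983Higgs3, (2.11) p.426] -/
theorem lineBoundOfPattern_ft (B₀₀ B₁₀ B₀₁ B₁₁ : X → X → ℝ) : lineBoundOfPattern false true B₀₀ B₁₀ B₀₁ B₁₁ = B₀₁ := rfl

/-- Both legs differentiated. [cite: Balaban1983Higgs3, (2.11) p.426] -/
theorem lineBoundOfPattern_tt (B₀₀ B₁₀ B₀₁ B₁₁ : X → X → ℝ) : lineBoundOfPattern true true B₀₀ B₁₀ B₀₁ B₁₁ = B₁₁ := rfl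

/-- The selected bound is non-negative when the four are. [cite: Balaban1983Higgs3, (2.10) p.426] -/
theorem lineBoundOfPattern_nonneg {B₀₀ B₁₀ B₀₁ B₁₁ : X → X → ℝ} (h00 : ∀ x x', 0 ≤ B₀₀ x x') (h10 : ∀ x x', 0 ≤ B₁₀ x x')
    (h01 : ∀ x x', 0 ≤ B₀₁ x x') (h11 : ∀ x x', 0 ≤ B₁₁ x x') (d₁ d₂ : Bool) (x x' : X) :
    0 ≤ lineBoundOfPattern d₁ d₂ B₀₀ B₁₀ B₀₁ B₁₁ x x' := by
  cases d₁ <;> cases d₂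
  · exact h00 x x'
  · exact h01 x x'
  · exact h10 x x'
  · exact h11 x x'

/-- **FILE 14's SCALAR-LINE HYPOTHESIS `hKs` FROM FOUR POSITION BOUNDS, DISPATCHED BY THE DIFFERENTIATION PATTERN** (any background): if the
entries of the line kernel `K` are dominated by `B₀₀` between the sites, its `dK1` (first leg differentiated, FILE 6) by `B₁₀` between the
bond's initial point and the site, its `dK2` by `B₀₁`, and its `dKs` (FILE 5) by `B₁₁`, then for EVERY pair of endpoint kinds, legs and
labels the signed contraction `Σ_{p,p′} σ₁(p)σ₂(p′)K(p,p′)` is dominated by the bound selected by `(isDiffLeg κ₁ j₁, isDiffLeg κ₂ j₂)` between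
the labels' positions — by `sigSK_trichotomy` and FILE 14's contraction identities `sum2_sigS_sigS` ∕ `sum2_sigD_sigS` ∕ `sum2_sigS_sigD` ∕
`sum2_sigD_sigD`. [cite: Balaban1983Higgs3, (2.10) p.426] [cite: Balaban1983Higgs3, (2.11) p.426] -/
theorem abs_sum2_sigSK_le_of_pattern (M : Model P N k)
    (K : HiggsLattice.Site P 0 × Fin N → HiggsLattice.Site P 0 × Fin N → ℝ)
    (B₀₀ B₁₀ B₀₁ B₁₁ : HiggsLattice.Site P 0 → HiggsLattice.Site P 0 → ℝ)
    (h00n : ∀ x x', 0 ≤ B₀₀ x x') (h10n : ∀ x x', 0 ≤ B₁₀ x x') (h01n : ∀ x x', 0 ≤ B₀₁ x x') (h11n : ∀ x x', 0 ≤ B₁₁ x x')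
    (h00 : ∀ (x : HiggsLattice.Site P 0) (c : Fin N) (x' : HiggsLattice.Site P 0) (c' : Fin N), |K (x, c) (x', c')| ≤ B₀₀ x x')
    (h10 : ∀ (b : HiggsLattice.PBond P 0) (c : Fin N) (x' : HiggsLattice.Site P 0) (c' : Fin N),
      |dK1 M.C M.B K b (EuclideanSpace.single c (1 : ℝ)) (x', c')| ≤ B₁₀ b.src x')
    (h01 : ∀ (x : HiggsLattice.Site P 0) (c : Fin N) (b' : HiggsLattice.PBond P 0) (c' : Fin N),
      |dK2 M.C M.B K (x, c) b' (EuclideanSpace.single c' (1 : ℝ))| ≤ B₀₁ x b'.src)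
    (h11 : ∀ (b : HiggsLattice.PBond P 0) (c : Fin N) (b' : HiggsLattice.PBond P 0) (c' : Fin N),
      |dKs M.C M.B K b (EuclideanSpace.single c (1 : ℝ)) b' (EuclideanSpace.single c' (1 : ℝ))| ≤ B₁₁ b.src b'.src)
    (κ₁ κ₂ : VertexKind) (j₁ : Fin κ₁.scalarLegs) (j₂ : Fin κ₂.scalarLegs) (ξ₁ ξ₂ : Lab P N) :
    |∑ p, ∑ p', sigSK M κ₁ j₁ ξ₁ p * sigSK M κ₂ j₂ ξ₂ p' * K p p'| ≤
      lineBoundOfPattern (isDiffLeg κ₁ j₁) (isDiffLeg κ₂ j₂) B₀₀ B₁₀ B₀₁ B₁₁ ξ₁.pos ξ₂.pos := by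
  have hnn := lineBoundOfPattern_nonneg h00n h10n h01n h11n (isDiffLeg κ₁ j₁) (isDiffLeg κ₂ j₂) ξ₁.pos ξ₂.pos
  rcases sigSK_trichotomy M κ₁ j₁ ξ₁ with h1 | ⟨hd1, c₁, h1⟩ | ⟨hd1, b₁, c₁, hp1, h1⟩
  · -- the first attachment vanishes
    rw [h1]
    simpa using hnn
  · rcases sigSK_trichotomy M κ₂ j₂ ξ₂ with h2 | ⟨hd2, c₂, h2⟩ | ⟨hd2, b₂, c₂, hp2, h2⟩
    · rw [h2]
      simpa using hnn
    · -- entry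
      rw [h1, h2, hd1, hd2, lineBoundOfPattern_ff, sum2_sigS_sigS]
      exact h00 _ _ _ _
    · -- second leg differentiated: `dK2`
      rw [h1, h2, hd1, hd2, lineBoundOfPattern_ft, sum2_sigS_sigD, hp2]
      exact h01 _ _ _ _
  · rcases sigSK_trichotomy M κ₂ j₂ ξ₂ with h2 | ⟨hd2, c₂, h2⟩ | ⟨hd2, b₂, c₂, hp2, h2⟩
    · rw [h2]
      simpa using hnn
    · -- first leg differentiated: `dK1`
      rw [h1, h2, hd1, hd2, lineBoundOfPattern_tf, sum2_sigD_sigS, hp1]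
      exact h10 _ _ _ _
    · -- both: `dKs`
      rw [h1, h2, hd1, hd2, lineBoundOfPattern_tt, sum2_sigD_sigD, hp1, hp2]
      exact h11 _ _ _ _

/-! ## §4 At zero background with the free kernel `G ⊗ 1_N`: the four bounds are bounds on `G`, `∂^ηG`, `G∂^{η*}`, `∂^ηG∂^{η*}` -/

/-- **ZERO BACKGROUND, FREE KERNEL**: if the model's background vanishes (`B̃ = 0`, `U ≡ 1`) and the scalar line carries the free kernel
`K((x,c),(x′,c′)) = [c = c′]·G(x,x′)`, then FILE 14's `hKs` holds for every pair of endpoint kinds ∕ legs ∕ labels with the bound selected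
by the differentiation pattern from bounds on `G` (`B₀₀`), on FILE 6's `dKernelL ε⁻¹ μ G` for all `μ` (`B₁₀`), `dKernelR ε⁻¹ μ′ G` (`B₀₁`)
and `d2KernelT ε⁻¹ μ μ′ G` (`B₁₁`) — FILE 15's `abs_dK1_zero_free_le` ∕ `abs_dK2_zero_free_le` ∕ `abs_dKs_zero_free_le`.
[cite: Balaban1983Higgs3, (2.10) p.426] [cite: Balaban1983Higgs3, (2.11) p.426] [cite: Balaban1982Higgs1, (1.7) p.605] -/
theorem abs_sum2_sigSK_free_zero_le (M : Model P N k) (hB : M.B = 0)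
    (G : HiggsLattice.Site P 0 → HiggsLattice.Site P 0 → ℝ)
    (B₀₀ B₁₀ B₀₁ B₁₁ : HiggsLattice.Site P 0 → HiggsLattice.Site P 0 → ℝ)
    (h00n : ∀ x x', 0 ≤ B₀₀ x x') (h10n : ∀ x x', 0 ≤ B₁₀ x x') (h01n : ∀ x x', 0 ≤ B₀₁ x x') (h11n : ∀ x x', 0 ≤ B₁₁ x x')
    (hG0 : ∀ x x', |G x x'| ≤ B₀₀ x x')
    (hG1 : ∀ (μ : Fin P.d) x x', |dKernelL (P.mesh 0)⁻¹ μ G x x'| ≤ B₁₀ x x')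
    (hG2 : ∀ (μ' : Fin P.d) y x', |dKernelR (P.mesh 0)⁻¹ μ' G y x'| ≤ B₀₁ y x')
    (hG3 : ∀ (μ μ' : Fin P.d) x x', |d2KernelT (P.mesh 0)⁻¹ μ μ' G x x'| ≤ B₁₁ x x')
    (κ₁ κ₂ : VertexKind) (j₁ : Fin κ₁.scalarLegs) (j₂ : Fin κ₂.scalarLegs) (ξ₁ ξ₂ : Lab P N) :
    |∑ p, ∑ p', sigSK M κ₁ j₁ ξ₁ p * sigSK M κ₂ j₂ ξ₂ p' * (if p.2 = p'.2 then G p.1 p'.1 else 0)| ≤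
      lineBoundOfPattern (isDiffLeg κ₁ j₁) (isDiffLeg κ₂ j₂) B₀₀ B₁₀ B₀₁ B₁₁ ξ₁.pos ξ₂.pos := by
  refine abs_sum2_sigSK_le_of_pattern M _ B₀₀ B₁₀ B₀₁ B₁₁ h00n h10n h01n h11n ?_ ?_ ?_ ?_ κ₁ κ₂ j₁ j₂ ξ₁ ξ₂
  · intro x c x' c'
    exact B3Ineq210ZeroHiggsTorus.abs_freeKernel_le G B₀₀ hG0 (x, c) (x', c')
  · rintro ⟨x, μ⟩ c x' c'
    rw [hB]
    exact (B3DifferentiatedLineKernels.abs_dK1_zero_free_le M.C G x μ c x' c').trans (hG1 μ x x')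
  · rintro x c ⟨x', μ'⟩ c'
    rw [hB]
    exact (B3DifferentiatedLineKernels.abs_dK2_zero_free_le M.C G x c x' μ' c').trans (hG2 μ' x x')
  · rintro ⟨x, μ⟩ c ⟨x', μ'⟩ c'
    rw [hB]
    exact (B3DifferentiatedLineKernels.abs_dKs_zero_free_le M.C G x x' μ μ' c c').trans (hG3 μ μ' x x')

/-- The selector against a family indexed by the NUMBER of differentiated legs: with `B₀₀ = T 0`, `B₁₀ = B₀₁ = T 1`, `B₁₁ = T 2` the
selected bound is `T n`, `n` = the number of differentiated legs of the line (print's count of the *"additional factor[s] (L^jη)^{−1}"*).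
[cite: Balaban1983Higgs3, (2.10) p.426] [cite: Balaban1983Higgs3, (2.11) p.426] -/
theorem lineBoundOfPattern_count (T : ℕ → X → X → ℝ) (d₁ d₂ : Bool) :
    lineBoundOfPattern d₁ d₂ (T 0) (T 1) (T 1) (T 2) = T (d₁.toNat + d₂.toNat) := by
  cases d₁ <;> cases d₂ <;> rfl

end Dispatch

/-! ## §5 The same dispatch for the VECTOR lines (`sigVK`: bond delta ∕ contour functional) and the OUTPUT pairs (`sigOK`) -/

section DispatchVO

variable {P : HiggsLattice.Params} {N k : ℕ} [DecidableEq (HiggsLattice.PBond P 0)]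

/-- **THE THREE SHAPES OF FILE 14's A′-LEG ATTACHMENT `sigVK M κ j ξ`**: identically zero (wrong label shape, or a kind without A′-legs),
OR — for the bond vertices (1.8)–(1.11), `isAveragingVertex κ = false` — the bond delta `sigB b` at the label's bond (`b₋` = the label's
position), OR — for the averaging vertices (1.14), (1.15), `isAveragingVertex κ = true` — the contour functional `β ↦ ctr(δ_β)(x)` of FILE 2's
`Model` at the label's position (print's `A′(Γ^{(j)}_{y,x})`, the object of (2.12)). [cite: Balaban1983Higgs3, (1.8) p.413]
[cite: Balaban1983Higgs3, (1.14) p.413] [cite: Balaban1983Higgs3, (2.12) p.426] -/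
theorem sigVK_trichotomy (M : Model P N k) (κ : VertexKind) (j : Fin κ.vectorLegs) (ξ : Lab P N) :
    (sigVK M κ j ξ = fun _ => 0) ∨
      (κ.isAveragingVertex = false ∧ ∃ b : HiggsLattice.PBond P 0, ξ.pos = b.src ∧ sigVK M κ j ξ = sigB b) ∨
      (κ.isAveragingVertex = true ∧ sigVK M κ j ξ = fun β => M.ctr (basisV β) ξ.pos) := by
  obtain ⟨s, c, c'⟩ := ξ
  cases κ with
  | v16 => exact Or.inl (funext fun β => by simp [sigVK])
  | v17 => exact Or.inl (funext fun β => by simp [sigVK])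
  | v18 n n' =>
    rcases s with x | b
    · exact Or.inl (funext fun β => by simp [sigVK])
    · exact Or.inr (Or.inl ⟨rfl, b, rfl, funext fun β => by simp [sigVK]⟩)
  | v19 n nb =>
    rcases s with x | b
    · exact Or.inl (funext fun β => by simp [sigVK])
    · exact Or.inr (Or.inl ⟨rfl, b, rfl, funext fun β => by simp [sigVK]⟩)
  | v110 n n' =>
    rcases s with x | b
    · exact Or.inl (funext fun β => by simp [sigVK])
    · exact Or.inr (Or.inl ⟨rfl, b, rfl, funext fun β => by simp [sigVK]⟩)
  | v111 n nb =>
    rcases s with x | b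
    · exact Or.inl (funext fun β => by simp [sigVK])
    · exact Or.inr (Or.inl ⟨rfl, b, rfl, funext fun β => by simp [sigVK]⟩)
  | v113 => exact Or.inl (funext fun β => by simp [sigVK])
  | v114 n n' =>
    rcases s with x | b
    · exact Or.inr (Or.inr ⟨rfl, funext fun β => by simp [sigVK, Lab.pos]⟩)
    · exact Or.inl (funext fun β => by simp [sigVK])
  | v115 n nb =>
    rcases s with x | b
    · exact Or.inr (Or.inr ⟨rfl, funext fun β => by simp [sigVK, Lab.pos]⟩)
    · exact Or.inl (funext fun β => by simp [sigVK])

/-- **FILE 14's VECTOR-LINE HYPOTHESIS `hKv` FROM FOUR POSITION BOUNDS, DISPATCHED BY THE AVERAGING PATTERN** of the line's two legs (FILE 2's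
contour functional LINEAR with weights `w`, as in FILE 14 §2): the entry of the vector kernel (`B_bb`, two bond-vertex legs), the SINGLY
contour-averaged kernel `Σ_b w(x,b)Kv(b,b′)` (`B_ab`: first leg averaged; `B_ba`: second) and the DOUBLY averaged one (`B_aa`) — print's (2.12):
*"If a leg A′ of the line is in one of the vertices (1.14) and (1.15) … For each such expression we have an additional factor L^jη"* as a
selector (`isAveragingVertex`). FILE 14's `sum2_sigB_sigB` ∕ `sum2_ctr_sigB` ∕ `sum2_sigB_ctr` ∕ `sum2_ctr_ctr`. [cite: Balaban1983Higgs3, (2.12) p.426]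
[cite: Balaban1983Higgs3, (2.10) p.426] -/
theorem abs_sum2_sigVK_le_of_pattern (M : Model P N k) (Kv : HiggsLattice.PBond P 0 → HiggsLattice.PBond P 0 → ℝ)
    (w : HiggsLattice.Site P 0 → HiggsLattice.PBond P 0 → ℝ) (hctr : ∀ a x, M.ctr a x = ∑ b, w x b * a b)
    (Bbb Bab Bba Baa : HiggsLattice.Site P 0 → HiggsLattice.Site P 0 → ℝ)
    (hbbn : ∀ x x', 0 ≤ Bbb x x') (habn : ∀ x x', 0 ≤ Bab x x') (hban : ∀ x x', 0 ≤ Bba x x') (haan : ∀ x x', 0 ≤ Baa x x')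
    (hbb : ∀ b b' : HiggsLattice.PBond P 0, |Kv b b'| ≤ Bbb b.src b'.src)
    (hab : ∀ (x : HiggsLattice.Site P 0) (b' : HiggsLattice.PBond P 0), |∑ b, w x b * Kv b b'| ≤ Bab x b'.src)
    (hba : ∀ (b : HiggsLattice.PBond P 0) (x' : HiggsLattice.Site P 0), |∑ b', w x' b' * Kv b b'| ≤ Bba b.src x')
    (haa : ∀ x x' : HiggsLattice.Site P 0, |∑ b, ∑ b', w x b * w x' b' * Kv b b'| ≤ Baa x x')
    (κ₁ κ₂ : VertexKind) (j₁ : Fin κ₁.vectorLegs) (j₂ : Fin κ₂.vectorLegs) (ξ₁ ξ₂ : Lab P N) :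
    |∑ β, ∑ β', sigVK M κ₁ j₁ ξ₁ β * sigVK M κ₂ j₂ ξ₂ β' * Kv β β'| ≤
      lineBoundOfPattern κ₁.isAveragingVertex κ₂.isAveragingVertex Bbb Bab Bba Baa ξ₁.pos ξ₂.pos := by
  have hnn := lineBoundOfPattern_nonneg hbbn habn hban haan κ₁.isAveragingVertex κ₂.isAveragingVertex ξ₁.pos ξ₂.pos
  rcases sigVK_trichotomy M κ₁ j₁ ξ₁ with h1 | ⟨ha1, b₁, hp1, h1⟩ | ⟨ha1, h1⟩
  · rw [h1]
    simpa using hnn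
  · rcases sigVK_trichotomy M κ₂ j₂ ξ₂ with h2 | ⟨ha2, b₂, hp2, h2⟩ | ⟨ha2, h2⟩
    · rw [h2]
      simpa using hnn
    · -- two bond legs: the entry
      rw [h1, h2, ha1, ha2, lineBoundOfPattern_ff, sum2_sigB_sigB, hp1, hp2]
      exact hbb _ _
    · -- bond leg against an averaged leg
      rw [h1, h2, ha1, ha2, lineBoundOfPattern_ft, hp1]
      dsimp only
      rw [sum2_sigB_ctr M.ctr w hctr]
      exact hba _ _
  · rcases sigVK_trichotomy M κ₂ j₂ ξ₂ with h2 | ⟨ha2, b₂, hp2, h2⟩ | ⟨ha2, h2⟩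
    · rw [h2]
      simpa using hnn
    · -- averaged leg against a bond leg
      rw [h1, h2, ha1, ha2, lineBoundOfPattern_tf, hp2]
      dsimp only
      rw [sum2_ctr_sigB M.ctr w hctr]
      exact hab _ _
    · -- two averaged legs
      rw [h1, h2, ha1, ha2, lineBoundOfPattern_tt]
      dsimp only
      rw [sum2_ctr_ctr M.ctr w hctr]
      exact haa _ _

omit [DecidableEq (HiggsLattice.PBond P 0)] in
/-- **THE TWO SHAPES OF FILE 14's OUTPUT ATTACHMENT `sigOK k κ j ξ`**: identically zero, or — for (1.13)–(1.15) at a site label — the delta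
`sigO` at the BLOCK POINT `x^{(k)}` of the label's position with some channel. [cite: Balaban1983Higgs3, (1.13) p.413]
[cite: Balaban1983Higgs3, (1.18) p.415] -/
theorem sigOK_dichotomy (κ : VertexKind) (j : Fin (outSlots κ)) (ξ : Lab P N) :
    (sigOK (P := P) (N := N) k κ j ξ = fun _ => 0) ∨ ∃ c : Fin N, sigOK k κ j ξ = sigO (blockIter k ξ.pos) c := by
  obtain ⟨s, c, c'⟩ := ξ
  cases κ with
  | v16 => exact Or.inl (funext fun r => by simp [sigOK])
  | v17 => exact Or.inl (funext fun r => by simp [sigOK])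
  | v18 n n' => exact Or.inl (funext fun r => by simp [sigOK])
  | v19 n nb => exact Or.inl (funext fun r => by simp [sigOK])
  | v110 n n' => exact Or.inl (funext fun r => by simp [sigOK])
  | v111 n nb => exact Or.inl (funext fun r => by simp [sigOK])
  | v113 =>
    rcases s with x | b
    · exact Or.inr ⟨c', funext fun r => by simp [sigOK, Lab.pos]⟩
    · exact Or.inl (funext fun r => by simp [sigOK])
  | v114 n n' =>
    rcases s with x | b
    · exact Or.inr ⟨c', funext fun r => by simp [sigOK, Lab.pos]⟩
    · exact Or.inl (funext fun r => by simp [sigOK])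
  | v115 n nb =>
    rcases s with x | b
    · exact Or.inr ⟨c', funext fun r => by simp [sigOK, Lab.pos]⟩
    · exact Or.inl (funext fun r => by simp [sigOK])

omit [DecidableEq (HiggsLattice.PBond P 0)] in
/-- **FILE 14's OUTPUT-PAIR HYPOTHESIS `hKo` FROM AN ENTRY BOUND OF THE (1.18) KERNEL AT BLOCK POINTS**: if `|Ko((x^{(k)},c),(x′^{(k)},c′))| ≤
B(x, x′)` for all fine sites and channels, then the contraction of `Ko` against the output attachments of any two labels is at most `B`
between the labels' positions (FILE 14's `sum2_sigO_sigO`). [cite: Balaban1983Higgs3, (1.18) p.415] -/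
theorem abs_sum2_sigOK_le (Ko : HiggsLattice.Site P k × Fin N → HiggsLattice.Site P k × Fin N → ℝ)
    (B : HiggsLattice.Site P 0 → HiggsLattice.Site P 0 → ℝ) (hBn : ∀ x x', 0 ≤ B x x')
    (hKo : ∀ (x : HiggsLattice.Site P 0) (c : Fin N) (x' : HiggsLattice.Site P 0) (c' : Fin N),
      |Ko (blockIter k x, c) (blockIter k x', c')| ≤ B x x')
    (κ₁ κ₂ : VertexKind) (j₁ : Fin (outSlots κ₁)) (j₂ : Fin (outSlots κ₂)) (ξ₁ ξ₂ : Lab P N) :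
    |∑ r, ∑ r', sigOK k κ₁ j₁ ξ₁ r * sigOK k κ₂ j₂ ξ₂ r' * Ko r r'| ≤ B ξ₁.pos ξ₂.pos := by
  rcases sigOK_dichotomy (P := P) (N := N) (k := k) κ₁ j₁ ξ₁ with h1 | ⟨c₁, h1⟩
  · rw [h1]
    simpa using hBn ξ₁.pos ξ₂.pos
  · rcases sigOK_dichotomy (P := P) (N := N) (k := k) κ₂ j₂ ξ₂ with h2 | ⟨c₂, h2⟩
    · rw [h2]
      simpa using hBn ξ₁.pos ξ₂.pos
    · rw [h1, h2, sum2_sigO_sigO]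
      exact hKo _ _ _ _

end DispatchVO

/-! ## §6 The tree's (2.10) fed in: the scalar lines carrying the free piece `G^η_{(j)}(T_η, 0) ⊗ 1_N` at zero background -/

section ZeroBackground

open Literature.MathematicalPhysics.QuantumFieldTheory.Balaban1983to89.B1Eq211ZeroFieldTorus (Shape)
open Literature.MathematicalPhysics.QuantumFieldTheory.Balaban1983to89.B1Eq211ZeroFieldTorusLevels (setupAt)
open Literature.MathematicalPhysics.QuantumFieldTheory.Balaban1983to89.B3Ineq210ZeroHiggsTorus (gpieceH gpieceH_bounds_model
  gpieceH_mixed_bound_model dKernelL_mesh0 dKernelR_mesh0 d2KernelT_mesh0)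

/-- **THE FOUR CLAUSES OF (2.10) FOR THE FREE PIECE `G^η_{(j)}(T_η, 0)` AT THE MODEL'S STEP-`k` DATA, ONE PAIR OF CONSTANTS**: FILE 16's
`gpieceH_bounds_model` (value; one differentiation at either end) and `gpieceH_mixed_bound_model` (one at each end) merged to a common
`δ₁ = min`, `C = max` — for `d ≥ 1`, odd `L > 1`, `a > 0`, `m² ≥ 0`: `|G| ≤ C s^{2−d}e^{−δ₁ s^{−1}(η·tdist)}`, `|∂^η_μ G|, |G∂^{η*}_μ| ≤
C s^{1−d}e^{…}`, `|∂^η_μ G ∂^{η*}_{μ′}| ≤ C s^{−d}e^{…}`, `s = L^jη` (`(setupAt S k).spacing j`), `η = (setupAt S k).eps`, uniformly in the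
volume, `1 ≤ k ≤ K` with `L^kε ≤ 1`, `j`, directions and sites. [cite: Balaban1983Higgs3, (2.10) p.426] -/
theorem gpieceH_four_bounds (d L : ℕ) (hd : 1 ≤ d) (hL : Odd L ∧ 1 < L) {a : ℝ} (ha : 0 < a) {m2 : ℝ} (hm2 : 0 ≤ m2) :
    ∃ δ₁ C : ℝ, 0 < δ₁ ∧ 0 < C ∧ ∀ (P : HiggsLattice.Params) (S : Shape P), P.d = d → P.L = L →
      ∀ (k : ℕ) (hk : k ≤ P.K), 1 ≤ k → P.mesh k ≤ 1 → ∀ (j : ℕ),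
        (∀ (x x' : HiggsLattice.Site P 0),
          |gpieceH S hk a (m2 * P.mesh k ^ 2) j x x'| ≤
            C * (setupAt S k).spacing j ^ ((2 : ℝ) - (P.d : ℝ)) *
              Real.exp (-(δ₁ * ((setupAt S k).spacing j)⁻¹ * ((setupAt S k).eps * (HiggsLattice.Site.tdist x x' : ℝ))))) ∧
        (∀ (μ : Fin P.d) (x x' : HiggsLattice.Site P 0),
          |dKernelL ((setupAt S k).eps)⁻¹ μ (gpieceH S hk a (m2 * P.mesh k ^ 2) j) x x'| ≤
            C * (setupAt S k).spacing j ^ ((1 : ℝ) - (P.d : ℝ)) *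
              Real.exp (-(δ₁ * ((setupAt S k).spacing j)⁻¹ * ((setupAt S k).eps * (HiggsLattice.Site.tdist x x' : ℝ))))) ∧
        (∀ (μ : Fin P.d) (y x' : HiggsLattice.Site P 0),
          |dKernelR ((setupAt S k).eps)⁻¹ μ (gpieceH S hk a (m2 * P.mesh k ^ 2) j) y x'| ≤
            C * (setupAt S k).spacing j ^ ((1 : ℝ) - (P.d : ℝ)) *
              Real.exp (-(δ₁ * ((setupAt S k).spacing j)⁻¹ * ((setupAt S k).eps * (HiggsLattice.Site.tdist y x' : ℝ))))) ∧
        (∀ (μ μ' : Fin P.d) (x x' : HiggsLattice.Site P 0),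
          |d2KernelT ((setupAt S k).eps)⁻¹ μ μ' (gpieceH S hk a (m2 * P.mesh k ^ 2) j) x x'| ≤
            C * (setupAt S k).spacing j ^ (-(P.d : ℝ)) *
              Real.exp (-(δ₁ * ((setupAt S k).spacing j)⁻¹ * ((setupAt S k).eps * (HiggsLattice.Site.tdist x x' : ℝ))))) := by
  obtain ⟨δa, Ca, hδa, hCa, hA⟩ := gpieceH_bounds_model d L hd hL ha hm2
  obtain ⟨δb, Cb, hδb, hCb, hB⟩ := gpieceH_mixed_bound_model d L hd hL ha hm2
  refine ⟨min δa δb, max Ca Cb, lt_min hδa hδb, lt_max_of_lt_left hCa, ?_⟩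
  intro P S hPd hPL k hk hk1 hmesh j
  obtain ⟨h0, h1, h2⟩ := hA P S hPd hPL k hk hk1 hmesh
  have h3 := hB P S hPd hPL k hk hk1 hmesh
  have hsp : 0 < (setupAt S k).spacing j := (setupAt S k).spacing_pos j
  have hε : 0 < (setupAt S k).eps := (setupAt S k).eps_pos
  -- weakening a clause `Cx · s^p · e^{−δx t}` to `max C · s^p · e^{−(min δ) t}`
  have weaken : ∀ {Cx δx p : ℝ} (_ : Cx ≤ max Ca Cb) (_ : min δa δb ≤ δx) {v : ℝ} (x x' : HiggsLattice.Site P 0),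
      v ≤ Cx * (setupAt S k).spacing j ^ p *
          Real.exp (-(δx * ((setupAt S k).spacing j)⁻¹ * ((setupAt S k).eps * (HiggsLattice.Site.tdist x x' : ℝ)))) →
      v ≤ max Ca Cb * (setupAt S k).spacing j ^ p *
          Real.exp (-(min δa δb * ((setupAt S k).spacing j)⁻¹ * ((setupAt S k).eps * (HiggsLattice.Site.tdist x x' : ℝ)))) := by
    intro Cx δx p hCx hδx v x x' hv
    refine hv.trans ?_
    have hsp' : 0 ≤ (setupAt S k).spacing j ^ p := Real.rpow_nonneg hsp.le _
    have ht : 0 ≤ ((setupAt S k).spacing j)⁻¹ * ((setupAt S k).eps * (HiggsLattice.Site.tdist x x' : ℝ)) := by positivity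
    have hexp : Real.exp (-(δx * ((setupAt S k).spacing j)⁻¹ * ((setupAt S k).eps * (HiggsLattice.Site.tdist x x' : ℝ)))) ≤
        Real.exp (-(min δa δb * ((setupAt S k).spacing j)⁻¹ * ((setupAt S k).eps * (HiggsLattice.Site.tdist x x' : ℝ)))) := by
      apply Real.exp_le_exp.2
      have := mul_le_mul_of_nonneg_right hδx ht
      nlinarith
    have hC0 : 0 ≤ max Ca Cb := hCa.le.trans (le_max_left _ _)
    calc Cx * (setupAt S k).spacing j ^ p *
          Real.exp (-(δx * ((setupAt S k).spacing j)⁻¹ * ((setupAt S k).eps * (HiggsLattice.Site.tdist x x' : ℝ))))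
        ≤ max Ca Cb * (setupAt S k).spacing j ^ p *
          Real.exp (-(δx * ((setupAt S k).spacing j)⁻¹ * ((setupAt S k).eps * (HiggsLattice.Site.tdist x x' : ℝ)))) :=
          mul_le_mul_of_nonneg_right (mul_le_mul_of_nonneg_right hCx hsp') (Real.exp_pos _).le
      _ ≤ _ := mul_le_mul_of_nonneg_left hexp (mul_nonneg hC0 hsp')
  refine ⟨fun x x' => ?_, fun μ x x' => ?_, fun μ y x' => ?_, fun μ μ' x x' => ?_⟩
  · exact weaken (le_max_left _ _) (min_le_left _ _) x x' (h0 j x x')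
  · exact weaken (le_max_left _ _) (min_le_left _ _) x x' (h1 j μ x x')
  · exact weaken (le_max_left _ _) (min_le_left _ _) y x' (h2 j μ y x')
  · exact weaken (le_max_right _ _) (min_le_right _ _) x x' (h3 j μ μ' x x')

variable {P : HiggsLattice.Params} {N : ℕ}

/-- **FILE 14's `hKs` DISCHARGED FOR THE SCALAR LINES OF A GRAPH AT ZERO BACKGROUND, IN THE TORUS SHAPE FILE 18 ∕ §1 CONSUME**: for
`d ≥ 1`, odd `L > 1`, `a > 0`, `m² ≥ 0` there are `δ₀ > 0`, `C > 0` such that for every torus of the model with a shape of p14's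
sub-family, every step `1 ≤ k ≤ K` with `L^kε ≤ 1`, every model datum of FILE 2 with VANISHING BACKGROUND (`B̃ = 0`), every scale index
`j` and EVERY pair of endpoint kinds, legs and labels, the signed contraction of the free piece `G^η_{(j)}(T_η,0) ⊗ 1_N` (FILE 16's
`gpieceH_j`) against FILE 14's attachments obeys `≤ C (L^kε)^{−n} (L^jη)^{2−d−n} exp[−2δ₀ (L^jη)^{−1} (η·tdist(positions))]`, `n` = the number
of differentiated legs of the line (`η = L^{−k}`; the factor `(L^kε)^{−n}` is the model's mesh normalization of the difference quotients,
FILE 16 §4) — the hypothesis `hKT` of `abs_graphAmp_le_ampE_signed_torusBlocks` for that line with `a_l = 2 − d − n_l`, `C_l = C(L^kε)^{−n_l}`.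
Sources: §3–§4 + `gpieceH_four_bounds`. [cite: Balaban1983Higgs3, (2.10) p.426] [cite: Balaban1983Higgs3, (2.11) p.426]
[cite: Balaban1983Higgs3, (2.13) p.426] -/
theorem hKs_scalarLine_zero_free (d L : ℕ) (hd : 1 ≤ d) (hL : Odd L ∧ 1 < L) {a : ℝ} (ha : 0 < a) {m2 : ℝ} (hm2 : 0 ≤ m2) :
    ∃ δ₀ C : ℝ, 0 < δ₀ ∧ 0 < C ∧ ∀ (P : HiggsLattice.Params) (S : Shape P), P.d = d → P.L = L →
      ∀ (k : ℕ) (hk : k ≤ P.K), 1 ≤ k → P.mesh k ≤ 1 → ∀ (N : ℕ) (M : Model P N k), M.B = 0 →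
        ∀ (j : ℕ) (κ₁ κ₂ : VertexKind) (j₁ : Fin κ₁.scalarLegs) (j₂ : Fin κ₂.scalarLegs) (ξ₁ ξ₂ : Lab P N),
          |∑ p, ∑ p', sigSK M κ₁ j₁ ξ₁ p * sigSK M κ₂ j₂ ξ₂ p' *
              (if p.2 = p'.2 then gpieceH S hk a (m2 * P.mesh k ^ 2) j p.1 p'.1 else 0)| ≤
            C * (P.mesh k)⁻¹ ^ ((isDiffLeg κ₁ j₁).toNat + (isDiffLeg κ₂ j₂).toNat) *
              ((P.L : ℝ) ^ j * ((P.L : ℝ) ^ k)⁻¹) ^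
                ((2 : ℝ) - (P.d : ℝ) - (((isDiffLeg κ₁ j₁).toNat + (isDiffLeg κ₂ j₂).toNat : ℕ) : ℝ)) *
              Real.exp (-(2 * δ₀ / ((P.L : ℝ) ^ j * ((P.L : ℝ) ^ k)⁻¹) *
                (((P.L : ℝ) ^ k)⁻¹ * (HiggsLattice.Site.tdist ξ₁.pos ξ₂.pos : ℝ)))) := by
  obtain ⟨δ₁, C, hδ₁, hC, h4⟩ := gpieceH_four_bounds d L hd hL ha hm2
  refine ⟨δ₁ / 2, C, half_pos hδ₁, hC, ?_⟩
  intro P S hPd hPL k hk hk1 hmesh N M hB j κ₁ κ₂ j₁ j₂ ξ₁ ξ₂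
  obtain ⟨h0, h1, h2, h3⟩ := h4 P S hPd hPL k hk hk1 hmesh j
  -- p19's scales are p14's: `L^j(L^k)⁻¹ = (setupAt S k).spacing j`, `(L^k)⁻¹ = (setupAt S k).eps`
  rw [← spacing_setupAt S k j, ← eps_setupAt S k]
  have hsp : 0 < (setupAt S k).spacing j := (setupAt S k).spacing_pos j
  have hε : 0 < (setupAt S k).eps := (setupAt S k).eps_pos
  have hmk : 0 < P.mesh k := P.mesh_pos k
  have e2 : 2 * (δ₁ / 2) / (setupAt S k).spacing j = δ₁ * ((setupAt S k).spacing j)⁻¹ := by ring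
  rw [e2]
  -- the bounds indexed by the number of differentiated legs
  set T : ℕ → HiggsLattice.Site P 0 → HiggsLattice.Site P 0 → ℝ := fun n x x' =>
    C * (P.mesh k)⁻¹ ^ n * (setupAt S k).spacing j ^ ((2 : ℝ) - (P.d : ℝ) - (n : ℝ)) *
      Real.exp (-(δ₁ * ((setupAt S k).spacing j)⁻¹ * ((setupAt S k).eps * (HiggsLattice.Site.tdist x x' : ℝ)))) with hT
  have hTn : ∀ n x x', 0 ≤ T n x x' := fun n x x' => by
    rw [hT]
    positivity
  have key := abs_sum2_sigSK_free_zero_le M hB (gpieceH S hk a (m2 * P.mesh k ^ 2) j) (T 0) (T 1) (T 1) (T 2)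
    (hTn 0) (hTn 1) (hTn 1) (hTn 2) ?_ ?_ ?_ ?_ κ₁ κ₂ j₁ j₂ ξ₁ ξ₂
  · rw [lineBoundOfPattern_count] at key
    simpa only [hT] using key
  · -- value
    intro x x'
    rw [hT]
    dsimp only
    rw [pow_zero, mul_one, Nat.cast_zero, sub_zero]
    exact h0 x x'
  · -- first leg differentiated: `(L^kε)⁻¹·∂^η_μ`
    intro μ x x'
    rw [dKernelL_mesh0 S, abs_mul, abs_of_pos (inv_pos.2 hmk), hT]
    dsimp only
    rw [pow_one, Nat.cast_one, show (2 : ℝ) - (P.d : ℝ) - 1 = 1 - (P.d : ℝ) by ring]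
    calc (P.mesh k)⁻¹ * |dKernelL ((setupAt S k).eps)⁻¹ μ (gpieceH S hk a (m2 * P.mesh k ^ 2) j) x x'|
        ≤ (P.mesh k)⁻¹ * (C * (setupAt S k).spacing j ^ ((1 : ℝ) - (P.d : ℝ)) *
            Real.exp (-(δ₁ * ((setupAt S k).spacing j)⁻¹ * ((setupAt S k).eps * (HiggsLattice.Site.tdist x x' : ℝ))))) :=
          mul_le_mul_of_nonneg_left (h1 μ x x') (inv_pos.2 hmk).le
      _ = _ := by ring
  · -- second leg differentiated
    intro μ' y x'
    rw [dKernelR_mesh0 S, abs_mul, abs_of_pos (inv_pos.2 hmk), hT]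
    dsimp only
    rw [pow_one, Nat.cast_one, show (2 : ℝ) - (P.d : ℝ) - 1 = 1 - (P.d : ℝ) by ring]
    calc (P.mesh k)⁻¹ * |dKernelR ((setupAt S k).eps)⁻¹ μ' (gpieceH S hk a (m2 * P.mesh k ^ 2) j) y x'|
        ≤ (P.mesh k)⁻¹ * (C * (setupAt S k).spacing j ^ ((1 : ℝ) - (P.d : ℝ)) *
            Real.exp (-(δ₁ * ((setupAt S k).spacing j)⁻¹ * ((setupAt S k).eps * (HiggsLattice.Site.tdist y x' : ℝ))))) :=
          mul_le_mul_of_nonneg_left (h2 μ' y x') (inv_pos.2 hmk).le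
      _ = _ := by ring
  · -- both legs differentiated: `(L^kε)⁻²·∂^η_μ G ∂^{η*}_{μ′}`
    intro μ μ' x x'
    have hmk2 : 0 < ((P.mesh k)⁻¹) ^ 2 := pow_pos (inv_pos.2 hmk) 2
    rw [d2KernelT_mesh0 S, abs_mul, abs_of_pos hmk2, hT]
    dsimp only
    rw [Nat.cast_two, show (2 : ℝ) - (P.d : ℝ) - 2 = -(P.d : ℝ) by ring]
    calc ((P.mesh k)⁻¹) ^ 2 * |d2KernelT ((setupAt S k).eps)⁻¹ μ μ' (gpieceH S hk a (m2 * P.mesh k ^ 2) j) x x'|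
        ≤ ((P.mesh k)⁻¹) ^ 2 * (C * (setupAt S k).spacing j ^ (-(P.d : ℝ)) *
            Real.exp (-(δ₁ * ((setupAt S k).spacing j)⁻¹ * ((setupAt S k).eps * (HiggsLattice.Site.tdist x x' : ℝ))))) :=
          mul_le_mul_of_nonneg_left (h3 μ μ' x x') hmk2.le
      _ = _ := by ring

end ZeroBackground

/-! ## §7 (v1.1) Vector lines joining two BOND vertices ((1.8)–(1.11)) at zero background: FILE 14's `hKv` from the entries of the free piece -/

section VectorZero

open Literature.MathematicalPhysics.QuantumFieldTheory.Balaban1983to89.B1Eq211ZeroFieldTorus (Shape)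
open Literature.MathematicalPhysics.QuantumFieldTheory.Balaban1983to89.B1Eq211ZeroFieldTorusLevels (setupAt)
open Literature.MathematicalPhysics.QuantumFieldTheory.Balaban1983to89.B3Ineq210ZeroHiggsTorus (gpieceH)

variable {P : HiggsLattice.Params} {N k : ℕ} [DecidableEq (HiggsLattice.PBond P 0)]

/-- **`hKv` FOR A LINE WITH NO AVERAGED LEG NEEDS ONLY THE ENTRY BOUND**: if both endpoint kinds are bond vertices ((1.8)–(1.11),
`isAveragingVertex = false`; or kinds without A′-legs), the signed contraction of any vector kernel `Kv` against FILE 14's attachments is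
bounded by any position majorant `B_bb ≥ 0` of its entries (§5's dispatch with the (2.12) cases excluded). [cite: Balaban1983Higgs3, (2.10) p.426]
[cite: Balaban1983Higgs3, (1.8) p.413] -/
theorem abs_sum2_sigVK_le_of_bondLegs (M : Model P N k) (Kv : HiggsLattice.PBond P 0 → HiggsLattice.PBond P 0 → ℝ)
    (Bbb : HiggsLattice.Site P 0 → HiggsLattice.Site P 0 → ℝ) (hbbn : ∀ x x', 0 ≤ Bbb x x')
    (hbb : ∀ b b' : HiggsLattice.PBond P 0, |Kv b b'| ≤ Bbb b.src b'.src)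
    (κ₁ κ₂ : VertexKind) (hκ₁ : κ₁.isAveragingVertex = false) (hκ₂ : κ₂.isAveragingVertex = false)
    (j₁ : Fin κ₁.vectorLegs) (j₂ : Fin κ₂.vectorLegs) (ξ₁ ξ₂ : Lab P N) :
    |∑ β, ∑ β', sigVK M κ₁ j₁ ξ₁ β * sigVK M κ₂ j₂ ξ₂ β' * Kv β β'| ≤ Bbb ξ₁.pos ξ₂.pos := by
  rcases sigVK_trichotomy M κ₁ j₁ ξ₁ with e1 | ⟨-, b₁, hp1, e1⟩ | ⟨ha1, -⟩
  · rw [e1]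
    simpa using hbbn _ _
  · rcases sigVK_trichotomy M κ₂ j₂ ξ₂ with e2 | ⟨-, b₂, hp2, e2⟩ | ⟨ha2, -⟩
    · rw [e2]
      simpa using hbbn _ _
    · rw [e1, e2, sum2_sigB_sigB, hp1, hp2]
      exact hbb _ _
    · rw [hκ₂] at ha2
      exact absurd ha2 (by decide)
  · rw [hκ₁] at ha1
    exact absurd ha1 (by decide)

/-- **FILE 14's `hKv` DISCHARGED AT ZERO BACKGROUND FOR THE VECTOR LINES JOINING TWO BOND VERTICES, IN THE TORUS SHAPE OF §1**: for `d ≥ 1`,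
odd `L > 1`, `a > 0`, `m² ≥ 0` there are `δ₀ > 0`, `C > 0` such that for every torus of the model with a shape of p14's sub-family, every step
`1 ≤ k ≤ K` with `L^kε ≤ 1`, every model datum of FILE 2, every scale index `j` and every pair of NON-AVERAGING endpoint kinds, legs and
labels, the signed contraction of the free vector piece `[μ = μ′]·G^η_{(j)}(T_η, 0; b₋, b′₋)` (FILE 16's `gpieceH_j` on the lower sites,
diagonal in the direction — the shape of `bondEntry_pieceA_zero`, *"the similar equality for the vector field propagator"* (2.6)) against
FILE 14's attachments obeys `≤ C (L^jη)^{2−d} exp[−2δ₀ (L^jη)^{−1} (η·tdist(positions))]` — the value clause of (2.10); A′-legs are never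
differentiated in the catalogue.  The lines with a leg in an averaging vertex (1.14), (1.15) need (2.12) (§5's `B_ab`, `B_ba`, `B_aa`) and
are NOT covered here. [cite: Balaban1983Higgs3, (2.10) p.426] [cite: Balaban1983Higgs3, (2.6) p.424] [cite: Balaban1983Higgs3, (2.13) p.426] -/
theorem hKv_vectorLine_zero_free_bondLegs (d L : ℕ) (hd : 1 ≤ d) (hL : Odd L ∧ 1 < L) {a : ℝ} (ha : 0 < a) {m2 : ℝ} (hm2 : 0 ≤ m2) :
    ∃ δ₀ C : ℝ, 0 < δ₀ ∧ 0 < C ∧ ∀ (P : HiggsLattice.Params) [DecidableEq (HiggsLattice.PBond P 0)] (S : Shape P), P.d = d → P.L = L →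
      ∀ (k : ℕ) (hk : k ≤ P.K), 1 ≤ k → P.mesh k ≤ 1 → ∀ (N : ℕ) (M : Model P N k) (j : ℕ) (κ₁ κ₂ : VertexKind),
        κ₁.isAveragingVertex = false → κ₂.isAveragingVertex = false →
        ∀ (j₁ : Fin κ₁.vectorLegs) (j₂ : Fin κ₂.vectorLegs) (ξ₁ ξ₂ : Lab P N),
          |∑ β, ∑ β', sigVK M κ₁ j₁ ξ₁ β * sigVK M κ₂ j₂ ξ₂ β' *
              (if β.dir = β'.dir then gpieceH S hk a (m2 * P.mesh k ^ 2) j β.src β'.src else 0)| ≤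
            C * ((P.L : ℝ) ^ j * ((P.L : ℝ) ^ k)⁻¹) ^ ((2 : ℝ) - (P.d : ℝ)) *
              Real.exp (-(2 * δ₀ / ((P.L : ℝ) ^ j * ((P.L : ℝ) ^ k)⁻¹) *
                (((P.L : ℝ) ^ k)⁻¹ * (HiggsLattice.Site.tdist ξ₁.pos ξ₂.pos : ℝ)))) := by
  obtain ⟨δ₁, C, hδ₁, hC, h4⟩ := gpieceH_four_bounds d L hd hL ha hm2
  refine ⟨δ₁ / 2, C, half_pos hδ₁, hC, ?_⟩
  intro P _ S hPd hPL k hk hk1 hmesh N M j κ₁ κ₂ hκ₁ hκ₂ j₁ j₂ ξ₁ ξ₂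
  obtain ⟨h0, -, -, -⟩ := h4 P S hPd hPL k hk hk1 hmesh j
  rw [← spacing_setupAt S k j, ← eps_setupAt S k]
  have hsp : 0 < (setupAt S k).spacing j := (setupAt S k).spacing_pos j
  have e2 : 2 * (δ₁ / 2) / (setupAt S k).spacing j = δ₁ * ((setupAt S k).spacing j)⁻¹ := by ring
  rw [e2]
  refine abs_sum2_sigVK_le_of_bondLegs M _
    (fun x x' => C * (setupAt S k).spacing j ^ ((2 : ℝ) - (P.d : ℝ)) *
      Real.exp (-(δ₁ * ((setupAt S k).spacing j)⁻¹ * ((setupAt S k).eps * (HiggsLattice.Site.tdist x x' : ℝ)))))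
    (fun x x' => by positivity) ?_ κ₁ κ₂ hκ₁ hκ₂ j₁ j₂ ξ₁ ξ₂
  intro b b'
  split_ifs with hdir
  · exact h0 b.src b'.src
  · rw [abs_zero]
    positivity

end VectorZero

end

end Literature.MathematicalPhysics.QuantumFieldTheory.Balaban1983to89.B3Ineq213TorusBlocksSigned
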